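import Literature.Analysis.FluidPDE.ClassicalL2StabilityForced
import Literature.Analysis.FluidPDE.PassiveScalarVelocityStability
import Literature.Analysis.FluidPDE.SerrinEnstrophyGronwall
import HarnessLib

/-!
# `L²` stability of classical solutions with the STRAIN RATE: the dissipation-aware shadowing
# estimate on `ℝ³` (explicit; no Sobolev constant, no unknown absolute constant)

Analysis/FluidPDE proof file (theorems only; no definitions, no named facts, no `sorry`). It is the
strain-rate twin of the tree's `exists_l2_stability` / `exists_l2_stability_forced`
(`ClassicalL2Stability(Forced).lean`, rate `C ν⁻³ (∫|∇u'|²)²` with an existential absolute `C`):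
for two classical solutions `(u, p)` (force `f`) and `(u', p')` (force `f'`) of the Navier–Stokes
system with the same viscosity `ν > 0` on `[0, T] × ℝ³`, both in the `L²`-Sobolev class of Tao's
smooth `H¹` theory, the difference `w = u − u'` obeys the ENERGY IDENTITY

  `d/dt ∫|w|² + 2ν ∫|∇w|² = −2 ∫ ⟪w, (∇u') w⟫ + 2 ∫ ⟪w, f − f'⟫`

— the transport term `∫⟪w, (u·∇)w⟫` of the UNKNOWN solution `u` and the pressure term vanish
exactly (`div u = div w = 0`), and the only production is the quadratic form of the velocity
gradient of the REFERENCE `u'`. Hence, if `G(t) ≥ sup_x λ_max(−sym ∇u'(t, x))` (the maximal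
COMPRESSION rate of the reference; any bound of the quadratic form `−⟪ξ, ∇u'(t,x) ξ⟫ ≤ G(t)|ξ|²`)
and `R(t) ≥ ‖f(t) − f'(t)‖_{L²}`, then

  `‖w(t)‖_{L²} ≤ (‖w(0)‖_{L²} + ∫₀ᵗ R) · exp (∫₀ᵗ G)`,  `2ν ∫₀ᵗ ‖∇w‖²_{L²} ≤ (same)²`

(`l2_stability_strain_forced`, `l2_dissipation_strain_forced`). This is the standard energy method
(Robinson–Rodrigo–Sadowski 2016, Ch. 6, the computation behind (6.3) and Thm. 6.10, with Hölder's
pointwise bound `|⟨(w·∇)u', w⟩| ≤ ‖(∇u')_sym‖_∞ ‖w‖²` in place of the Ladyzhenskaya/Sobolev bound),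
written with DIFFERENT forces so that the reference may be a numerically computed field `u'` forced
by its own residual `f'` (the a-posteriori use of Dashti–Robinson 2008 and Chernyshenko–Constantin–
Robinson–Titi 2007 — there in `H¹`/`H^s` currency with rates built from global Sobolev norms of the
reference; here in `L²` currency with the pointwise strain rate and no constant).

## Contents

* `l2_slice_strain_identity` — one time slice: for `C²` divergence-free bounded `v, v'` with
  `Wᵢ + (vᵢ·∇)vᵢ = νΔvᵢ − ∇qᵢ` and `vᵢ, Dvᵢ, D²vᵢ, Wᵢ, qᵢ, Dqᵢ ∈ L²`:
  `2∫⟪v − v', W₁ − W₂⟫ = −2ν ∫|∇(v − v')|²_F − 2∫⟪v − v', Dv'(x)(v − v')⟫` (the proof of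
  `exists_l2_slice` up to its step (iv), verbatim);
* `l2_slice_strain` — with `−⟪ξ, Dv'(x) ξ⟫ ≤ G‖ξ‖²`:
  `2∫⟪v − v', W₁ − W₂⟫ + 2ν ∫|∇(v − v')|²_F ≤ 2G ∫‖v − v'‖²`;
* `sqrt_le_mul_exp_of_le_add_intervalIntegral` — the square-root Grönwall lemma for
  `φ(t) ≤ φ(0) + ∫₀ᵗ (2Gφ + 2R√φ)` (integrating factor + `Torus.sqrt_le_sqrt_add_integral_of_hasDerivWithinAt`);
* `l2_stability_strain_forced` — the slab theorem; `l2_stability_strain_forced_const` — constant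
  `G`, `R`; `l2_dissipation_strain_forced` — the dissipation budget.

## References

* J. C. Robinson, J. L. Rodrigo, W. Sadowski, *The Three-Dimensional Navier–Stokes Equations*,
  CUP 2016, Ch. 6 ((6.3), proof of Thm. 6.10) and Ch. 9 (Thm. 9.1, robustness of regularity).
  [RobinsonRodrigoSadowski2016]
* M. Dashti, J. C. Robinson, SIAM J. Numer. Anal. 46 (2008) 3136–3150 (a posteriori condition).
  [DashtiRobinson2008]
* T. Tao, Anal. PDE 6 (2013) = arXiv:1108.1165, Thm. 5.4 (v). [Tao2011]
-/

noncomputable section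

open MeasureTheory Set Function Filter InnerProductSpace
open _root_.Topology
open scoped ENNReal NNReal ContDiff RealInnerProductSpace Laplacian

namespace Literature.Analysis.FluidPDE

/-! ### One time slice: the energy identity of the difference -/

section Slice

set_option maxHeartbeats 800000 in
/-- **The energy identity of the difference, one time slice.** If `v, v' : ℝ³ → ℝ³` are `C²`,
divergence free and bounded, `W₁, W₂ : ℝ³ → ℝ³`, `q₁, q₂ : ℝ³ → ℝ` are `C¹` with the momentum
equations `Wᵢ + (vᵢ·∇)vᵢ = νΔvᵢ − ∇qᵢ`, and `vᵢ, Dvᵢ, D²vᵢ, Wᵢ, qᵢ, Dqᵢ ∈ L²`, then, with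
`w = v − v'`,
`2∫⟪w, W₁ − W₂⟫ = −2ν ∫|∇w|²_F − 2∫⟪w, Dv'(x) w⟫`:
`W₁ − W₂ = νΔw − ∇(q₁ − q₂) − (v·∇)w − (w·∇)v'`; the diffusion term is `−ν∫|∇w|²`
(`integral_sum_inner_fderiv_fderiv_eq_neg_integral_inner_laplacian`), the pressure and transport
terms vanish (`integral_inner_gradient_eq_zero_of_isDivFree_R3`,
`integral_inner_weakGrad_apply_self_eq_zero`), and the stretching term `(w·∇)v' = Dv'(x) w` is
kept as it is (steps (i)–(iii) of the proof of `exists_l2_slice`, verbatim).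
[cite: RobinsonRodrigoSadowski2016, Thm. 6.10 (proof), (6.3)] -/
theorem l2_slice_strain_identity {ν : ℝ}
    {v v' W₁ W₂ : EuclideanSpace ℝ (Fin 3) → EuclideanSpace ℝ (Fin 3)}
    {q₁ q₂ : EuclideanSpace ℝ (Fin 3) → ℝ}
    (hv : ContDiff ℝ 2 v) (hv' : ContDiff ℝ 2 v') (hW₁ : ContDiff ℝ 1 W₁) (hW₂ : ContDiff ℝ 1 W₂)
    (hq₁ : ContDiff ℝ 1 q₁) (hq₂ : ContDiff ℝ 1 q₂)
    (hmom₁ : ∀ x, W₁ x + FluidPDE.convect v v x = ν • (Δ v) x - gradient q₁ x)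
    (hmom₂ : ∀ x, W₂ x + FluidPDE.convect v' v' x = ν • (Δ v') x - gradient q₂ x)
    (hdiv : VectorCalculus.IsDivFree v) (hdiv' : VectorCalculus.IsDivFree v')
    {B : ℝ} (hB : ∀ x, ‖v x‖ ≤ B) (hB' : ∀ x, ‖v' x‖ ≤ B)
    (hv0 : ∫⁻ x, ‖v x‖ₑ ^ 2 < ⊤) (hv1 : ∫⁻ x, ‖iteratedFDeriv ℝ 1 v x‖ₑ ^ 2 < ⊤)
    (hv2 : ∫⁻ x, ‖iteratedFDeriv ℝ 2 v x‖ₑ ^ 2 < ⊤)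
    (hv'0 : ∫⁻ x, ‖v' x‖ₑ ^ 2 < ⊤) (hv'1 : ∫⁻ x, ‖iteratedFDeriv ℝ 1 v' x‖ₑ ^ 2 < ⊤)
    (hv'2 : ∫⁻ x, ‖iteratedFDeriv ℝ 2 v' x‖ₑ ^ 2 < ⊤)
    (hW₁0 : ∫⁻ x, ‖W₁ x‖ₑ ^ 2 < ⊤) (hW₂0 : ∫⁻ x, ‖W₂ x‖ₑ ^ 2 < ⊤)
    (hq₁0 : ∫⁻ x, ‖q₁ x‖ₑ ^ 2 < ⊤) (hq₁1 : ∫⁻ x, ‖iteratedFDeriv ℝ 1 q₁ x‖ₑ ^ 2 < ⊤)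
    (hq₂0 : ∫⁻ x, ‖q₂ x‖ₑ ^ 2 < ⊤) (hq₂1 : ∫⁻ x, ‖iteratedFDeriv ℝ 1 q₂ x‖ₑ ^ 2 < ⊤) :
    2 * ∫ x, ⟪v x - v' x, W₁ x - W₂ x⟫ =
      -(2 * ν * ∫ x, FluidPDE.frobeniusNormSq (fderiv ℝ (fun y => v y - v' y) x)) -
        2 * ∫ x, ⟪v x - v' x, fderiv ℝ v' x (v x - v' x)⟫ := by
  set e := EuclideanSpace.basisFun (Fin 3) ℝ with he
  have he1 : ∀ i, ‖e i‖ = 1 := fun i => by simp [he]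
  have hB0 : 0 ≤ B := (norm_nonneg _).trans (hB 0)
  -- the differences `w = v - v'`, `W = W₁ - W₂`, `π = q₁ - q₂` (opaque, with equations)
  obtain ⟨w, hwdef⟩ : ∃ w : EuclideanSpace ℝ (Fin 3) → EuclideanSpace ℝ (Fin 3),
      w = fun x => v x - v' x := ⟨_, rfl⟩
  obtain ⟨W, hWdef⟩ : ∃ W : EuclideanSpace ℝ (Fin 3) → EuclideanSpace ℝ (Fin 3),
      W = fun x => W₁ x - W₂ x := ⟨_, rfl⟩
  obtain ⟨π, hπdef⟩ : ∃ π : EuclideanSpace ℝ (Fin 3) → ℝ, π = fun x => q₁ x - q₂ x := ⟨_, rfl⟩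
  have hwx : ∀ x, w x = v x - v' x := fun x => by rw [hwdef]
  have hWx : ∀ x, W x = W₁ x - W₂ x := fun x => by rw [hWdef]
  have hπx : ∀ x, π x = q₁ x - q₂ x := fun x => by rw [hπdef]
  have hw : ContDiff ℝ 2 w := by rw [hwdef]; exact hv.sub hv'
  have hw1 : ContDiff ℝ 1 w := hw.of_le (by norm_num)
  have hW : ContDiff ℝ 1 W := by rw [hWdef]; exact hW₁.sub hW₂
  have hπ : ContDiff ℝ 1 π := by rw [hπdef]; exact hq₁.sub hq₂
  have hdv : Differentiable ℝ v := hv.differentiable (by norm_num)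
  have hdv' : Differentiable ℝ v' := hv'.differentiable (by norm_num)
  have hdw : Differentiable ℝ w := hw1.differentiable one_ne_zero
  have hdq₁ : Differentiable ℝ q₁ := hq₁.differentiable one_ne_zero
  have hdq₂ : Differentiable ℝ q₂ := hq₂.differentiable one_ne_zero
  have hfdw : ∀ x, fderiv ℝ w x = fderiv ℝ v x - fderiv ℝ v' x := fun x => by
    rw [hwdef]; exact fderiv_fun_sub (hdv x) (hdv' x)
  have hΔw : ∀ x, (Δ w) x = (Δ v) x - (Δ v') x := fun x => by
    have h := hv.contDiffAt.laplacian_sub hv'.contDiffAt (x := x)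
    rw [hwdef]
    exact h
  have hgradπ : ∀ x, gradient π x = gradient q₁ x - gradient q₂ x := fun x => by
    rw [hπdef, gradient, gradient, gradient, fderiv_fun_sub (hdq₁ x) (hdq₂ x), map_sub]
  have hdivw : VectorCalculus.IsDivFree w := by
    intro x
    rw [FluidPDE.divergence_eq_traceCLM, hfdw x, map_sub, ← FluidPDE.divergence_eq_traceCLM,
      ← FluidPDE.divergence_eq_traceCLM, hdiv x, hdiv' x, sub_zero]
  -- the momentum equation of the difference
  have hmom : ∀ x, W x = ν • (Δ w) x - gradient π x - FluidPDE.convect v w x - FluidPDE.convect w v' x := by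
    intro x
    have h1 := hmom₁ x
    have h2 := hmom₂ x
    have hc : FluidPDE.convect v v x - FluidPDE.convect v' v' x =
        FluidPDE.convect v w x + FluidPDE.convect w v' x := by
      simp only [FluidPDE.convect, hfdw x, hwx x, FunLike.coe_sub, Pi.sub_apply, map_sub]
      abel
    have h1' : W₁ x = ν • (Δ v) x - gradient q₁ x - FluidPDE.convect v v x := eq_sub_of_add_eq h1
    have h2' : W₂ x = ν • (Δ v') x - gradient q₂ x - FluidPDE.convect v' v' x := eq_sub_of_add_eq h2
    rw [hWx, h1', h2', hΔw, hgradπ, smul_sub]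
    have : FluidPDE.convect v v x = FluidPDE.convect v' v' x +
        (FluidPDE.convect v w x + FluidPDE.convect w v' x) := by rw [← hc]; abel
    rw [this]
    abel
  -- continuity
  have cv : Continuous v := hv.continuous
  have cv' : Continuous v' := hv'.continuous
  have cw : Continuous w := hw.continuous
  have cDv : Continuous (fderiv ℝ v) := hv.continuous_fderiv (by norm_num)
  have cDv' : Continuous (fderiv ℝ v') := hv'.continuous_fderiv (by norm_num)
  have cDw : Continuous (fderiv ℝ w) := hw.continuous_fderiv (by norm_num)
  have cD2v : Continuous fun x => iteratedFDeriv ℝ 2 v x := hv.continuous_iteratedFDeriv le_rfl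
  have cD2v' : Continuous fun x => iteratedFDeriv ℝ 2 v' x := hv'.continuous_iteratedFDeriv le_rfl
  have cD2w : Continuous fun x => iteratedFDeriv ℝ 2 w x := hw.continuous_iteratedFDeriv le_rfl
  have cW₁ : Continuous W₁ := hW₁.continuous
  have cW : Continuous W := hW.continuous
  have cq₁ : Continuous q₁ := hq₁.continuous
  have cπ : Continuous π := hπ.continuous
  have cDq₁ : Continuous (fderiv ℝ q₁) := hq₁.continuous_fderiv one_ne_zero
  have cDq₂ : Continuous (fderiv ℝ q₂) := hq₂.continuous_fderiv one_ne_zero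
  have cDπ : Continuous (fderiv ℝ π) := hπ.continuous_fderiv one_ne_zero
  have hΔ1 : ContDiff ℝ 0 (Δ w) := by
    have h : Δ w = fun y => ∑ i, fderiv ℝ (fun z => fderiv ℝ w z (e i)) y (e i) :=
      funext fun y => FluidPDE.laplacian_eq_sum_fderiv_fderiv e hw y
    rw [h]
    exact ContDiff.sum fun i _ =>
      ((hw.fderiv_right (m := 1) (by norm_num)).clm_apply contDiff_const).fderiv_right
        (m := 0) (by norm_num) |>.clm_apply contDiff_const
  have cΔ : Continuous (Δ w) := hΔ1.continuous
  have cdiw : ∀ i, Continuous fun x => fderiv ℝ w x (e i) := fun i => cDw.clm_apply continuous_const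
  have cddw : ∀ i, Continuous fun x => fderiv ℝ (fun y => fderiv ℝ w y (e i)) x (e i) := fun i =>
    ((((hw.fderiv_right (m := 1) (by norm_num)).clm_apply contDiff_const).continuous_fderiv
      (by norm_num)).clm_apply continuous_const)
  have cdiπ : ∀ i, Continuous fun x => fderiv ℝ π x (e i) := fun i => cDπ.clm_apply continuous_const
  have cgπ : Continuous (gradient π) := by
    have : gradient π = fun x => (InnerProductSpace.toDual ℝ _).symm (fderiv ℝ π x) := rfl
    rw [this]
    exact (InnerProductSpace.toDual ℝ (EuclideanSpace ℝ (Fin 3))).symm.continuous.comp cDπ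
  -- pointwise bounds
  have hwB : ∀ x, ‖w x‖ ≤ 2 * B := fun x => by
    rw [hwx]; exact (norm_sub_le _ _).trans (by linarith [hB x, hB' x])
  have hDv_eq : ∀ x, ‖fderiv ℝ v x‖ = ‖iteratedFDeriv ℝ 1 v x‖ := fun x => by
    rw [← norm_iteratedFDeriv_fderiv, norm_iteratedFDeriv_zero]
  have hDv'_eq : ∀ x, ‖fderiv ℝ v' x‖ = ‖iteratedFDeriv ℝ 1 v' x‖ := fun x => by
    rw [← norm_iteratedFDeriv_fderiv, norm_iteratedFDeriv_zero]
  have hD2w : ∀ x, iteratedFDeriv ℝ 2 w x = iteratedFDeriv ℝ 2 v x - iteratedFDeriv ℝ 2 v' x :=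
    fun x => by rw [hwdef]; exact fun_iteratedFDeriv_sub_apply hv.contDiffAt hv'.contDiffAt
  have n_Δ : ∀ x, ‖(Δ w) x‖ ≤ ‖(3 : ℝ) • iteratedFDeriv ℝ 2 w x‖ := fun x => by
    rw [norm_smul, Real.norm_of_nonneg (by norm_num : (0 : ℝ) ≤ 3)]
    exact norm_laplacian_le_three_mul_norm_iteratedFDeriv_two hw x
  have n_gπ : ∀ x, ‖gradient π x‖ = ‖fderiv ℝ π x‖ := fun x => by
    rw [gradient, LinearIsometryEquiv.norm_map]
  have hfdπ : ∀ x, fderiv ℝ π x = fderiv ℝ q₁ x - fderiv ℝ q₂ x := fun x => by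
    rw [hπdef]; exact fderiv_fun_sub (hdq₁ x) (hdq₂ x)
  have hDq₁_eq : ∀ x, ‖fderiv ℝ q₁ x‖ = ‖iteratedFDeriv ℝ 1 q₁ x‖ := fun x => by
    rw [← norm_iteratedFDeriv_fderiv, norm_iteratedFDeriv_zero]
  have hDq₂_eq : ∀ x, ‖fderiv ℝ q₂ x‖ = ‖iteratedFDeriv ℝ 1 q₂ x‖ := fun x => by
    rw [← norm_iteratedFDeriv_fderiv, norm_iteratedFDeriv_zero]
  have hin : ∀ i (y : EuclideanSpace ℝ (Fin 3)), ‖⟪e i, y⟫‖ ≤ ‖y‖ := fun i y =>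
    (norm_inner_le_norm (𝕜 := ℝ) (e i) y).trans (by rw [he1, one_mul])
  -- finite `L²` norms
  have l2w : ∫⁻ x, ‖w x‖ₑ ^ 2 < ⊤ := by
    refine lintegral_enorm_sq_lt_top_of_norm_le_add (fun x => ?_) cv.aestronglyMeasurable hv0 hv'0
    rw [hwx]; exact norm_sub_le _ _
  have l2Dv : ∫⁻ x, ‖fderiv ℝ v x‖ₑ ^ 2 < ⊤ :=
    lintegral_enorm_sq_lt_top_of_norm_le (fun x => (hDv_eq x).le) hv1
  have l2Dv' : ∫⁻ x, ‖fderiv ℝ v' x‖ₑ ^ 2 < ⊤ :=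
    lintegral_enorm_sq_lt_top_of_norm_le (fun x => (hDv'_eq x).le) hv'1
  have l2Dw : ∫⁻ x, ‖fderiv ℝ w x‖ₑ ^ 2 < ⊤ := by
    refine lintegral_enorm_sq_lt_top_of_norm_le_add (fun x => ?_) cDv.aestronglyMeasurable l2Dv l2Dv'
    rw [hfdw]; exact norm_sub_le _ _
  have l2D2w : ∫⁻ x, ‖iteratedFDeriv ℝ 2 w x‖ₑ ^ 2 < ⊤ := by
    refine lintegral_enorm_sq_lt_top_of_norm_le_add (fun x => ?_) cD2v.aestronglyMeasurable hv2 hv'2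
    rw [hD2w]; exact norm_sub_le _ _
  have l2Δ : ∫⁻ x, ‖(Δ w) x‖ₑ ^ 2 < ⊤ :=
    lintegral_enorm_sq_lt_top_of_norm_le n_Δ (lintegral_enorm_sq_const_smul_lt_top 3 l2D2w)
  have l2W : ∫⁻ x, ‖W x‖ₑ ^ 2 < ⊤ := by
    refine lintegral_enorm_sq_lt_top_of_norm_le_add (fun x => ?_) cW₁.aestronglyMeasurable hW₁0 hW₂0
    rw [hWx]; exact norm_sub_le _ _
  have l2π : ∫⁻ x, ‖π x‖ₑ ^ 2 < ⊤ := by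
    refine lintegral_enorm_sq_lt_top_of_norm_le_add (fun x => ?_) cq₁.aestronglyMeasurable hq₁0 hq₂0
    rw [hπx]; exact norm_sub_le _ _
  have l2Dπ : ∫⁻ x, ‖fderiv ℝ π x‖ₑ ^ 2 < ⊤ := by
    refine lintegral_enorm_sq_lt_top_of_norm_le_add (fun x => ?_) cDq₁.aestronglyMeasurable
      (lintegral_enorm_sq_lt_top_of_norm_le (fun x => (hDq₁_eq x).le) hq₁1)
      (lintegral_enorm_sq_lt_top_of_norm_le (fun x => (hDq₂_eq x).le) hq₂1)
    rw [hfdπ]; exact norm_sub_le _ _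
  have l2gπ : ∫⁻ x, ‖gradient π x‖ₑ ^ 2 < ⊤ :=
    lintegral_enorm_sq_lt_top_of_norm_le (fun x => (n_gπ x).le) l2Dπ
  have l2diw : ∀ i, ∫⁻ x, ‖fderiv ℝ w x (e i)‖ₑ ^ 2 < ⊤ := fun i =>
    lintegral_enorm_sq_lt_top_of_norm_le (fun x => by
      simpa [he1] using (fderiv ℝ w x).le_opNorm (e i)) l2Dw
  have l2ddw : ∀ i, ∫⁻ x, ‖fderiv ℝ (fun y => fderiv ℝ w y (e i)) x (e i)‖ₑ ^ 2 < ⊤ := fun i =>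
    lintegral_enorm_sq_lt_top_of_norm_le (fun x => norm_fderiv_fderiv_apply_basisFun_le hw x i) l2D2w
  have l2diπ : ∀ i, ∫⁻ x, ‖fderiv ℝ π x (e i)‖ₑ ^ 2 < ⊤ := fun i =>
    lintegral_enorm_sq_lt_top_of_norm_le (fun x => by
      simpa [he1] using (fderiv ℝ π x).le_opNorm (e i)) l2Dπ
  have l2conv₁ : ∫⁻ x, ‖FluidPDE.convect v w x‖ₑ ^ 2 < ⊤ := by
    have hb : ∫⁻ x, ‖B * ‖fderiv ℝ w x‖‖ₑ ^ 2 < ⊤ := by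
      have h := lintegral_enorm_sq_const_smul_lt_top B
        (lintegral_enorm_sq_lt_top_of_norm_le (fun x => by rw [norm_norm]) l2Dw :
          ∫⁻ x, ‖(‖fderiv ℝ w x‖)‖ₑ ^ 2 < ⊤)
      simpa only [smul_eq_mul] using h
    refine lintegral_enorm_sq_lt_top_of_norm_le (fun x => ?_) hb
    rw [Real.norm_of_nonneg (by positivity), FluidPDE.convect, mul_comm]
    exact (fderiv ℝ w x).le_opNorm_of_le (hB x)
  have l2conv₂ : ∫⁻ x, ‖FluidPDE.convect w v' x‖ₑ ^ 2 < ⊤ := by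
    have hb : ∫⁻ x, ‖(2 * B) * ‖fderiv ℝ v' x‖‖ₑ ^ 2 < ⊤ := by
      have h := lintegral_enorm_sq_const_smul_lt_top (2 * B)
        (lintegral_enorm_sq_lt_top_of_norm_le (fun x => by rw [norm_norm]) l2Dv' :
          ∫⁻ x, ‖(‖fderiv ℝ v' x‖)‖ₑ ^ 2 < ⊤)
      simpa only [smul_eq_mul] using h
    refine lintegral_enorm_sq_lt_top_of_norm_le (fun x => ?_) hb
    rw [Real.norm_of_nonneg (by positivity), FluidPDE.convect, mul_comm]
    exact (fderiv ℝ v' x).le_opNorm_of_le (hwB x)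
  -- integrability of the pairings with `w`
  have c3D2 : Continuous fun x => (3 : ℝ) • iteratedFDeriv ℝ 2 w x := cD2w.const_smul (3 : ℝ)
  have iwΔ : Integrable (fun x => ⟪w x, (Δ w) x⟫) volume :=
    integrable_of_norm_le_mul_of_lintegral_sq (cw.inner cΔ).aestronglyMeasurable cw c3D2 l2w
      (lintegral_enorm_sq_const_smul_lt_top 3 l2D2w)
      fun x => (norm_inner_le_norm _ _).trans (mul_le_mul_of_nonneg_left (n_Δ x) (norm_nonneg _))
  have iwg : Integrable (fun x => ⟪w x, gradient π x⟫) volume :=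
    integrable_of_norm_le_mul_of_lintegral_sq (cw.inner cgπ).aestronglyMeasurable cw cgπ l2w l2gπ
      fun x => norm_inner_le_norm _ _
  have cconv₁ : Continuous (FluidPDE.convect v w) := cDw.clm_apply cv
  have cconv₂ : Continuous (FluidPDE.convect w v') := cDv'.clm_apply cw
  have iwc₁ : Integrable (fun x => ⟪w x, FluidPDE.convect v w x⟫) volume :=
    integrable_of_norm_le_mul_of_lintegral_sq (cw.inner cconv₁).aestronglyMeasurable cw cconv₁ l2w
      l2conv₁ fun x => norm_inner_le_norm _ _
  have iwc₂ : Integrable (fun x => ⟪w x, FluidPDE.convect w v' x⟫) volume :=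
    integrable_of_norm_le_mul_of_lintegral_sq (cw.inner cconv₂).aestronglyMeasurable cw cconv₂ l2w
      l2conv₂ fun x => norm_inner_le_norm _ _
  -- (i) diffusion: `∫ ⟪w, Δw⟫ = -∫ |∇w|²`
  have ifrob : Integrable (fun x => FluidPDE.frobeniusNormSq (fderiv ℝ w x)) volume := by
    have hlt : ∫⁻ x, ENNReal.ofReal (FluidPDE.frobeniusNormSq (fderiv ℝ w x)) < ⊤ :=
      calc ∫⁻ x, ENNReal.ofReal (FluidPDE.frobeniusNormSq (fderiv ℝ w x))
          ≤ ∫⁻ x, 3 * ‖fderiv ℝ w x‖ₑ ^ 2 :=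
            lintegral_mono fun x => ofReal_frobeniusNormSq_le_three_mul_enorm_sq _
        _ = 3 * ∫⁻ x, ‖fderiv ℝ w x‖ₑ ^ 2 := lintegral_const_mul' _ _ (by norm_num)
        _ < ⊤ := ENNReal.mul_lt_top (by norm_num) l2Dw
    exact integrable_of_continuous_of_nonneg (FluidPDE.continuous_frobeniusNormSq_fderiv hw (by simp))
      (fun x => FluidPDE.frobeniusNormSq_nonneg _) hlt
  have hlfrob : ∫⁻ x, ENNReal.ofReal (FluidPDE.frobeniusNormSq (fderiv ℝ w x)) =
      ENNReal.ofReal (∫ x, FluidPDE.frobeniusNormSq (fderiv ℝ w x)) :=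
    (ofReal_integral_eq_lintegral_ofReal ifrob
      (Eventually.of_forall fun x => FluidPDE.frobeniusNormSq_nonneg _)).symm
  have hdiff : ∫ x, ⟪w x, (Δ w) x⟫ = - ∫ x, FluidPDE.frobeniusNormSq (fderiv ℝ w x) := by
    have i1 : ∀ i, Integrable (fun x => ⟪fderiv ℝ (fun y => fderiv ℝ w y (e i)) x (e i), w x⟫)
        volume := fun i =>
      integrable_of_norm_le_mul_of_lintegral_sq ((cddw i).inner cw).aestronglyMeasurable (cddw i) cw
        (l2ddw i) l2w fun x => norm_inner_le_norm _ _
    have i2 : ∀ i, Integrable (fun x => ⟪fderiv ℝ w x (e i), fderiv ℝ w x (e i)⟫) volume := fun i =>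
      integrable_of_norm_le_mul_of_lintegral_sq ((cdiw i).inner (cdiw i)).aestronglyMeasurable
        (cdiw i) (cdiw i) (l2diw i) (l2diw i) fun x => norm_inner_le_norm _ _
    have i3 : ∀ i, Integrable (fun x => ⟪fderiv ℝ w x (e i), w x⟫) volume := fun i =>
      integrable_of_norm_le_mul_of_lintegral_sq ((cdiw i).inner cw).aestronglyMeasurable (cdiw i) cw
        (l2diw i) l2w fun x => norm_inner_le_norm _ _
    have hG := integral_sum_inner_fderiv_fderiv_eq_neg_integral_inner_laplacian hw hw1 i1 i2 i3
    have hsum : ∫ x, ∑ i, ⟪fderiv ℝ w x (e i), fderiv ℝ w x (e i)⟫ =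
        ∫ x, FluidPDE.frobeniusNormSq (fderiv ℝ w x) := by
      refine integral_congr_ae (Eventually.of_forall fun x => ?_)
      simp only
      rw [FluidPDE.frobeniusNormSq_eq_sum e]
      exact Finset.sum_congr rfl fun i _ => real_inner_self_eq_norm_sq _
    have hcomm : ∫ x, ⟪w x, (Δ w) x⟫ = ∫ x, ⟪(Δ w) x, w x⟫ :=
      integral_congr_ae (Eventually.of_forall fun x => real_inner_comm _ _)
    rw [hcomm]
    linarith [hG, hsum]
  -- (ii) pressure: `∫ ⟪w, ∇π⟫ = 0`
  have hpress : ∫ x, ⟪w x, gradient π x⟫ = 0 := by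
    have hswap : (fun x => ⟪w x, gradient π x⟫) = fun x => ⟪gradient π x, w x⟫ :=
      funext fun x => real_inner_comm _ _
    rw [hswap]
    refine integral_inner_gradient_eq_zero_of_isDivFree_R3 hπ hw1 hdivw (fun i => ?_) (fun i => ?_)
      (fun i => ?_)
    · refine integrable_of_norm_le_mul_of_lintegral_sq
        ((continuous_const.inner cw).mul (cdiπ i)).aestronglyMeasurable cw (cdiπ i) l2w (l2diπ i)
        fun x => ?_
      rw [norm_mul]
      exact mul_le_mul (hin i _) le_rfl (norm_nonneg _) (norm_nonneg _)
    · refine integrable_of_norm_le_mul_of_lintegral_sq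
        ((continuous_const.inner (cdiw i)).mul cπ).aestronglyMeasurable (cdiw i) cπ (l2diw i) l2π
        fun x => ?_
      rw [norm_mul]
      exact mul_le_mul (hin i _) le_rfl (norm_nonneg _) (norm_nonneg _)
    · refine integrable_of_norm_le_mul_of_lintegral_sq
        ((continuous_const.inner cw).mul cπ).aestronglyMeasurable cw cπ l2w l2π fun x => ?_
      rw [norm_mul]
      exact mul_le_mul (hin i _) le_rfl (norm_nonneg _) (norm_nonneg _)
  -- (iii) transport: `∫ ⟪w, (v·∇)w⟫ = 0`
  have hwm : MemLp w 2 volume :=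
    ⟨cw.aestronglyMeasurable, eLpNorm_two_lt_top_of_lintegral_enorm_sq_lt_top l2w⟩
  have htrans : ∫ x, ⟪w x, FluidPDE.convect v w x⟫ = 0 := by
    have hwd : IsWeaklyDivFree v :=
      VectorCalculus.IsDivFree.isWeaklyDivFree_holds hdiv (hv.of_le (by norm_num))
    have hwg : HasWeakGradient w (fderiv ℝ w) := hasWeakGradient_fderiv_of_contDiff hw1
    have hG2 : ∫⁻ x, ENNReal.ofReal (FluidPDE.frobeniusNormSq (fderiv ℝ w x)) < ⊤ := by
      rw [hlfrob]; exact ENNReal.ofReal_lt_top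
    have hvtop : MemLp v ⊤ volume :=
      memLp_top_of_bound cv.aestronglyMeasurable B (Eventually.of_forall hB)
    have h := integral_inner_weakGrad_apply_self_eq_zero hwd hwg hG2 hwm (q := ⊤) (p := 2)
      (by norm_num) hvtop hwm
    have hswap : (fun x => ⟪w x, FluidPDE.convect v w x⟫) = fun x => ⟪fderiv ℝ w x (v x), w x⟫ :=
      funext fun x => by rw [FluidPDE.convect, real_inner_comm]
    rw [hswap]
    exact h
  -- (iv) the stretching term is kept: `T = ∫ ⟪w, (w·∇)v'⟫ = ∫ ⟪w, Dv'(x) w⟫`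
  obtain ⟨DF, hDF⟩ : ∃ DF : ℝ, DF = ∫ x, FluidPDE.frobeniusNormSq (fderiv ℝ w x) := ⟨_, rfl⟩
  obtain ⟨T, hT⟩ : ∃ T : ℝ, T = ∫ x, ⟪w x, FluidPDE.convect w v' x⟫ := ⟨_, rfl⟩
  -- the identity `∫ ⟪w, W⟫ = -ν DF - T`
  have hident : ∫ x, ⟪w x, W x⟫ = -ν * DF - T := by
    have hpt : ∀ x, ⟪w x, W x⟫ =
        ν * ⟪w x, (Δ w) x⟫ - ⟪w x, gradient π x⟫ - ⟪w x, FluidPDE.convect v w x⟫ -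
          ⟪w x, FluidPDE.convect w v' x⟫ := fun x => by
      rw [hmom x, inner_sub_right, inner_sub_right, inner_sub_right, real_inner_smul_right]
    have iA : Integrable (fun x => ν * ⟪w x, (Δ w) x⟫) volume := iwΔ.const_mul ν
    have iAB : Integrable (fun x => ν * ⟪w x, (Δ w) x⟫ - ⟪w x, gradient π x⟫) volume := by
      exact iA.sub iwg
    have iABC : Integrable (fun x => ν * ⟪w x, (Δ w) x⟫ - ⟪w x, gradient π x⟫ -
        ⟪w x, FluidPDE.convect v w x⟫) volume := by
      exact iAB.sub iwc₁
    have e1 : ∫ x, (ν * ⟪w x, (Δ w) x⟫ - ⟪w x, gradient π x⟫ - ⟪w x, FluidPDE.convect v w x⟫ -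
        ⟪w x, FluidPDE.convect w v' x⟫) =
        (∫ x, (ν * ⟪w x, (Δ w) x⟫ - ⟪w x, gradient π x⟫ - ⟪w x, FluidPDE.convect v w x⟫)) -
          ∫ x, ⟪w x, FluidPDE.convect w v' x⟫ := integral_sub iABC iwc₂
    have e2 : ∫ x, (ν * ⟪w x, (Δ w) x⟫ - ⟪w x, gradient π x⟫ - ⟪w x, FluidPDE.convect v w x⟫) =
        (∫ x, (ν * ⟪w x, (Δ w) x⟫ - ⟪w x, gradient π x⟫)) - ∫ x, ⟪w x, FluidPDE.convect v w x⟫ :=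
      integral_sub iAB iwc₁
    have e3 : ∫ x, (ν * ⟪w x, (Δ w) x⟫ - ⟪w x, gradient π x⟫) =
        (∫ x, ν * ⟪w x, (Δ w) x⟫) - ∫ x, ⟪w x, gradient π x⟫ := integral_sub iA iwg
    have e4 : ∫ x, ν * ⟪w x, (Δ w) x⟫ = ν * ∫ x, ⟪w x, (Δ w) x⟫ := integral_const_mul _ _
    rw [integral_congr_ae (Eventually.of_forall hpt), e1, e2, e3, e4, hdiff, hpress, htrans, ← hT,
      ← hDF]
    ring
  -- conclude
  have hgoal : 2 * ∫ x, ⟪v x - v' x, W₁ x - W₂ x⟫ = 2 * ∫ x, ⟪w x, W x⟫ := by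
    congr 1
    exact integral_congr_ae (Eventually.of_forall fun x => by simp only [hwx, hWx])
  have hDFgoal : ∫ x, FluidPDE.frobeniusNormSq (fderiv ℝ (fun y => v y - v' y) x) = DF := by
    rw [hDF, hwdef]
  have hTgoal : ∫ x, ⟪v x - v' x, fderiv ℝ v' x (v x - v' x)⟫ = T := by
    rw [hT]
    exact integral_congr_ae (Eventually.of_forall fun x => by simp only [hwx, FluidPDE.convect])
  rw [hgoal, hDFgoal, hTgoal, hident]
  ring

/-- **The strain-rate slice inequality.** Under the hypotheses of `l2_slice_strain_identity`, if the
quadratic form of the reference gradient is bounded, `−⟪ξ, Dv'(x) ξ⟫ ≤ G‖ξ‖²` for all `x, ξ`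
(e.g. `G = sup_x λ_max(−sym Dv'(x))`, the maximal compression rate, or crudely `G = sup_x ‖Dv'(x)‖`),
then `2∫⟪v − v', W₁ − W₂⟫ + 2ν ∫|∇(v − v')|²_F ≤ 2G ∫‖v − v'‖²` — Hölder's pointwise bound in
place of the Ladyzhenskaya–Sobolev bound of `exists_l2_slice`; no constant.
[cite: RobinsonRodrigoSadowski2016, Thm. 6.10 (proof), (6.3)] -/
theorem l2_slice_strain {ν : ℝ}
    {v v' W₁ W₂ : EuclideanSpace ℝ (Fin 3) → EuclideanSpace ℝ (Fin 3)}
    {q₁ q₂ : EuclideanSpace ℝ (Fin 3) → ℝ}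
    (hv : ContDiff ℝ 2 v) (hv' : ContDiff ℝ 2 v') (hW₁ : ContDiff ℝ 1 W₁) (hW₂ : ContDiff ℝ 1 W₂)
    (hq₁ : ContDiff ℝ 1 q₁) (hq₂ : ContDiff ℝ 1 q₂)
    (hmom₁ : ∀ x, W₁ x + FluidPDE.convect v v x = ν • (Δ v) x - gradient q₁ x)
    (hmom₂ : ∀ x, W₂ x + FluidPDE.convect v' v' x = ν • (Δ v') x - gradient q₂ x)
    (hdiv : VectorCalculus.IsDivFree v) (hdiv' : VectorCalculus.IsDivFree v')
    {B : ℝ} (hB : ∀ x, ‖v x‖ ≤ B) (hB' : ∀ x, ‖v' x‖ ≤ B)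
    (hv0 : ∫⁻ x, ‖v x‖ₑ ^ 2 < ⊤) (hv1 : ∫⁻ x, ‖iteratedFDeriv ℝ 1 v x‖ₑ ^ 2 < ⊤)
    (hv2 : ∫⁻ x, ‖iteratedFDeriv ℝ 2 v x‖ₑ ^ 2 < ⊤)
    (hv'0 : ∫⁻ x, ‖v' x‖ₑ ^ 2 < ⊤) (hv'1 : ∫⁻ x, ‖iteratedFDeriv ℝ 1 v' x‖ₑ ^ 2 < ⊤)
    (hv'2 : ∫⁻ x, ‖iteratedFDeriv ℝ 2 v' x‖ₑ ^ 2 < ⊤)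
    (hW₁0 : ∫⁻ x, ‖W₁ x‖ₑ ^ 2 < ⊤) (hW₂0 : ∫⁻ x, ‖W₂ x‖ₑ ^ 2 < ⊤)
    (hq₁0 : ∫⁻ x, ‖q₁ x‖ₑ ^ 2 < ⊤) (hq₁1 : ∫⁻ x, ‖iteratedFDeriv ℝ 1 q₁ x‖ₑ ^ 2 < ⊤)
    (hq₂0 : ∫⁻ x, ‖q₂ x‖ₑ ^ 2 < ⊤) (hq₂1 : ∫⁻ x, ‖iteratedFDeriv ℝ 1 q₂ x‖ₑ ^ 2 < ⊤)
    {G : ℝ} (hG : ∀ x ξ, -⟪ξ, fderiv ℝ v' x ξ⟫ ≤ G * ‖ξ‖ ^ 2) :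
    2 * (∫ x, ⟪v x - v' x, W₁ x - W₂ x⟫) +
        2 * ν * (∫ x, FluidPDE.frobeniusNormSq (fderiv ℝ (fun y => v y - v' y) x)) ≤
      2 * G * ∫ x, ‖v x - v' x‖ ^ 2 := by
  have hid := l2_slice_strain_identity hv hv' hW₁ hW₂ hq₁ hq₂ hmom₁ hmom₂ hdiv hdiv' hB hB' hv0 hv1
    hv2 hv'0 hv'1 hv'2 hW₁0 hW₂0 hq₁0 hq₁1 hq₂0 hq₂1
  -- the stretching integral is bounded pointwise by the quadratic form bound
  have cv : Continuous v := hv.continuous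
  have cv' : Continuous v' := hv'.continuous
  have cw : Continuous fun x => v x - v' x := cv.sub cv'
  have cDv' : Continuous (fderiv ℝ v') := hv'.continuous_fderiv (by norm_num)
  have hB0 : 0 ≤ B := (norm_nonneg _).trans (hB 0)
  have hwB : ∀ x, ‖v x - v' x‖ ≤ 2 * B := fun x =>
    (norm_sub_le _ _).trans (by linarith [hB x, hB' x])
  have l2w : ∫⁻ x, ‖v x - v' x‖ₑ ^ 2 < ⊤ :=
    lintegral_enorm_sq_lt_top_of_norm_le_add (fun x => norm_sub_le _ _) cv.aestronglyMeasurable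
      hv0 hv'0
  have hDv'_eq : ∀ x, ‖fderiv ℝ v' x‖ = ‖iteratedFDeriv ℝ 1 v' x‖ := fun x => by
    rw [← norm_iteratedFDeriv_fderiv, norm_iteratedFDeriv_zero]
  have l2Dv' : ∫⁻ x, ‖fderiv ℝ v' x‖ₑ ^ 2 < ⊤ :=
    lintegral_enorm_sq_lt_top_of_norm_le (fun x => (hDv'_eq x).le) hv'1
  have isq : Integrable (fun x => ‖v x - v' x‖ ^ 2) volume :=
    FluidPDE.integrable_sq_norm_of_lintegral_lt_top cw l2w
  have cconv : Continuous fun x => fderiv ℝ v' x (v x - v' x) := cDv'.clm_apply cw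
  have l2conv : ∫⁻ x, ‖fderiv ℝ v' x (v x - v' x)‖ₑ ^ 2 < ⊤ := by
    have hb : ∫⁻ x, ‖(2 * B) * ‖fderiv ℝ v' x‖‖ₑ ^ 2 < ⊤ := by
      have h := lintegral_enorm_sq_const_smul_lt_top (2 * B)
        (lintegral_enorm_sq_lt_top_of_norm_le (fun x => by rw [norm_norm]) l2Dv' :
          ∫⁻ x, ‖(‖fderiv ℝ v' x‖)‖ₑ ^ 2 < ⊤)
      simpa only [smul_eq_mul] using h
    refine lintegral_enorm_sq_lt_top_of_norm_le (fun x => ?_) hb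
    rw [Real.norm_of_nonneg (by positivity), mul_comm]
    exact (fderiv ℝ v' x).le_opNorm_of_le (hwB x)
  have istr : Integrable (fun x => ⟪v x - v' x, fderiv ℝ v' x (v x - v' x)⟫) volume :=
    integrable_of_norm_le_mul_of_lintegral_sq (cw.inner cconv).aestronglyMeasurable cw cconv l2w
      l2conv fun x => norm_inner_le_norm _ _
  have hstr : -(∫ x, ⟪v x - v' x, fderiv ℝ v' x (v x - v' x)⟫) ≤ G * ∫ x, ‖v x - v' x‖ ^ 2 := by
    rw [← integral_neg, ← integral_const_mul]
    exact integral_mono istr.neg (isq.const_mul G) fun x => hG x (v x - v' x)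
  rw [hid]
  linarith

end Slice

/-! ### The square-root Grönwall lemma with a linear and a square-root forcing -/

section Real

/-- **Square-root Grönwall lemma (integral form).** If `φ ≥ 0` is continuous on `[0, T]`, `G, R ≥ 0`
are continuous on `[0, T]`, and `φ(t) ≤ φ(0) + ∫₀ᵗ (2Gφ + 2R√φ)` for `t ∈ [0, T]`, then
`√φ(t) ≤ (√φ(0) + ∫₀ᵗ R) · exp(∫₀ᵗ G)` on `[0, T]`: the right-hand side `Ψ` is differentiable with
`Ψ' = 2Gφ + 2R√φ ≤ 2GΨ + 2R√Ψ`, so `χ = e^{−2∫G} Ψ` has `χ' ≤ 2R√χ` and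
`Torus.sqrt_le_sqrt_add_integral_of_hasDerivWithinAt` gives `√χ(t) ≤ √φ(0) + ∫₀ᵗ R` — i.e.
Grönwall's lemma `η' ≤ Gη + R ⇒ η(t) ≤ e^{∫G}(η(0) + ∫R)` (Robinson–Rodrigo–Sadowski 2016,
Lemma A.24) for `η = √φ`, in the integral form of their Lemma A.25.
[cite: RobinsonRodrigoSadowski2016, Lemma A.24 and Lemma A.25 (Gronwall), applied to η = √φ] -/
theorem sqrt_le_mul_exp_of_le_add_intervalIntegral {T : ℝ} {φ G R : ℝ → ℝ}
    (hφc : ContinuousOn φ (Icc 0 T)) (hφ0 : ∀ t ∈ Icc 0 T, 0 ≤ φ t)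
    (hGc : ContinuousOn G (Icc 0 T)) (hRc : ContinuousOn R (Icc 0 T))
    (hG0 : ∀ t ∈ Icc 0 T, 0 ≤ G t) (hR0 : ∀ t ∈ Icc 0 T, 0 ≤ R t)
    (hle : ∀ t ∈ Icc 0 T,
      φ t ≤ φ 0 + ∫ s in (0 : ℝ)..t, (2 * G s * φ s + 2 * R s * Real.sqrt (φ s))) :
    ∀ t ∈ Icc 0 T, Real.sqrt (φ t) ≤
      (Real.sqrt (φ 0) + ∫ s in (0 : ℝ)..t, R s) * Real.exp (∫ s in (0 : ℝ)..t, G s) := by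
  intro t ht
  rcases eq_or_lt_of_le ht.1 with h0 | h0
  · rw [← h0, intervalIntegral.integral_same, intervalIntegral.integral_same, add_zero,
      Real.exp_zero, mul_one]
  have hsub : Icc 0 t ⊆ Icc 0 T := Icc_subset_Icc le_rfl ht.2
  -- the integrand `k = 2Gφ + 2R√φ`, the primitive `Ψ`, the exponent `A = ∫G`
  obtain ⟨k, hk⟩ : ∃ k : ℝ → ℝ, k = fun s => 2 * G s * φ s + 2 * R s * Real.sqrt (φ s) :=
    ⟨_, rfl⟩
  have hks : ∀ s, k s = 2 * G s * φ s + 2 * R s * Real.sqrt (φ s) := fun s => by rw [hk]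
  have hkc : ContinuousOn k (Icc 0 t) := by
    rw [hk]
    exact (((continuousOn_const.mul hGc).mul hφc).add
      ((continuousOn_const.mul hRc).mul hφc.sqrt)).mono hsub
  have hGc' : ContinuousOn G (Icc 0 t) := hGc.mono hsub
  have hRc' : ContinuousOn R (Icc 0 t) := hRc.mono hsub
  obtain ⟨Ψ, hΨ⟩ : ∃ Ψ : ℝ → ℝ, Ψ = fun s => φ 0 + ∫ σ in (0 : ℝ)..s, k σ := ⟨_, rfl⟩
  have hΨs : ∀ s, Ψ s = φ 0 + ∫ σ in (0 : ℝ)..s, k σ := fun s => by rw [hΨ]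
  obtain ⟨A, hA⟩ : ∃ A : ℝ → ℝ, A = fun s => ∫ σ in (0 : ℝ)..s, G σ := ⟨_, rfl⟩
  have hAs : ∀ s, A s = ∫ σ in (0 : ℝ)..s, G σ := fun s => by rw [hA]
  -- derivatives within `[0, t]`
  have hprim : ∀ {g : ℝ → ℝ}, ContinuousOn g (Icc 0 t) → ∀ s ∈ Icc 0 t,
      HasDerivWithinAt (fun u => ∫ σ in (0 : ℝ)..u, g σ) (g s) (Icc 0 t) s := by
    intro g hg s hs
    haveI : Fact (s ∈ Icc 0 t) := ⟨hs⟩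
    have hgi : IntervalIntegrable g volume 0 s :=
      (hg.mono (Icc_subset_Icc_right hs.2)).intervalIntegrable_of_Icc hs.1
    exact intervalIntegral.integral_hasDerivWithinAt_right hgi
      (hg.stronglyMeasurableAtFilter_nhdsWithin measurableSet_Icc s) (hg s hs)
  have hΨd : ∀ s ∈ Icc 0 t, HasDerivWithinAt Ψ (k s) (Icc 0 t) s := by
    intro s hs
    rw [hΨ]
    exact (hprim hkc s hs).const_add (φ 0)
  have hAd : ∀ s ∈ Icc 0 t, HasDerivWithinAt A (G s) (Icc 0 t) s := by
    intro s hs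
    rw [hA]
    exact hprim hGc' s hs
  have hAc : ContinuousOn A (Icc 0 t) := fun s hs => (hAd s hs).continuousWithinAt
  have hΨc : ContinuousOn Ψ (Icc 0 t) := fun s hs => (hΨd s hs).continuousWithinAt
  -- signs
  have hA0 : ∀ s ∈ Icc 0 t, 0 ≤ A s := by
    intro s hs
    rw [hAs]
    exact intervalIntegral.integral_nonneg hs.1 fun σ hσ => hG0 σ (hsub ⟨hσ.1, hσ.2.trans hs.2⟩)
  have hφΨ : ∀ s ∈ Icc 0 t, φ s ≤ Ψ s := by
    intro s hs
    rw [hΨs]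
    have h := hle s (hsub hs)
    simpa only [hks] using h
  have hΨ0 : ∀ s ∈ Icc 0 t, 0 ≤ Ψ s := fun s hs => (hφ0 s (hsub hs)).trans (hφΨ s hs)
  -- `χ = e^{-2A} Ψ`
  obtain ⟨χ, hχ⟩ : ∃ χ : ℝ → ℝ, χ = fun s => Real.exp (-2 * A s) * Ψ s := ⟨_, rfl⟩
  have hχs : ∀ s, χ s = Real.exp (-2 * A s) * Ψ s := fun s => by rw [hχ]
  obtain ⟨D, hD⟩ : ∃ D : ℝ → ℝ,
      D = fun s => Real.exp (-2 * A s) * (-2 * G s) * Ψ s + Real.exp (-2 * A s) * k s := ⟨_, rfl⟩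
  have hDs : ∀ s, D s = Real.exp (-2 * A s) * (-2 * G s) * Ψ s + Real.exp (-2 * A s) * k s :=
    fun s => by rw [hD]
  have hχd : ∀ s ∈ Icc 0 t, HasDerivWithinAt χ (D s) (Icc 0 t) s := by
    intro s hs
    have h1 : HasDerivWithinAt (fun u => Real.exp (-2 * A u)) (Real.exp (-2 * A s) * (-2 * G s))
        (Icc 0 t) s := ((hAd s hs).const_mul (-2)).exp
    have h2 := h1.mul (hΨd s hs)
    rw [hχ, hDs]
    exact h2
  have hDc : ContinuousOn D (Icc 0 t) := by
    rw [hD]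
    have hexp : ContinuousOn (fun s => Real.exp (-2 * A s)) (Icc 0 t) :=
      (continuousOn_const.mul hAc).rexp
    exact ((hexp.mul (continuousOn_const.mul hGc')).mul hΨc).add (hexp.mul hkc)
  have hχ0 : ∀ s ∈ Icc 0 t, 0 ≤ χ s := fun s hs => by
    rw [hχs]; exact mul_nonneg (Real.exp_nonneg _) (hΨ0 s hs)
  -- `D ≤ 2 √χ R`
  have hDle : ∀ s ∈ Icc 0 t, D s ≤ 2 * Real.sqrt (χ s) * R s := by
    intro s hs
    have hG := hG0 s (hsub hs)
    have hR := hR0 s (hsub hs)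
    have hφ := hφ0 s (hsub hs)
    have hφΨs := hφΨ s hs
    have hE0 : 0 < Real.exp (-2 * A s) := Real.exp_pos _
    have hE1 : Real.exp (-2 * A s) ≤ Real.exp (-A s) :=
      Real.exp_le_exp.2 (by linarith [hA0 s hs])
    -- `D = e^{-2A} (2R√φ - 2G(Ψ - φ)) ≤ e^{-2A} 2R√φ ≤ e^{-A} 2R√φ ≤ 2R e^{-A}√Ψ = 2R√χ`
    have hsqrt : Real.sqrt (χ s) = Real.exp (-A s) * Real.sqrt (Ψ s) := by
      rw [hχs, Real.sqrt_mul (Real.exp_nonneg _)]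
      congr 1
      rw [show -2 * A s = -A s + -A s by ring, Real.exp_add, Real.sqrt_mul_self (Real.exp_nonneg _)]
    have hφΨsqrt : Real.sqrt (φ s) ≤ Real.sqrt (Ψ s) := Real.sqrt_le_sqrt hφΨs
    have hstep1 : D s ≤ Real.exp (-2 * A s) * (2 * R s * Real.sqrt (φ s)) := by
      rw [hDs, hks]
      have : Real.exp (-2 * A s) * (-2 * G s) * Ψ s +
          Real.exp (-2 * A s) * (2 * G s * φ s + 2 * R s * Real.sqrt (φ s)) =
          Real.exp (-2 * A s) * (2 * R s * Real.sqrt (φ s)) -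
            Real.exp (-2 * A s) * (2 * G s * (Ψ s - φ s)) := by ring
      rw [this]
      have hnn : 0 ≤ Real.exp (-2 * A s) * (2 * G s * (Ψ s - φ s)) :=
        mul_nonneg hE0.le (mul_nonneg (by positivity) (by linarith))
      linarith
    have hstep2 : Real.exp (-2 * A s) * (2 * R s * Real.sqrt (φ s)) ≤
        Real.exp (-A s) * (2 * R s * Real.sqrt (Ψ s)) :=
      mul_le_mul hE1 (mul_le_mul_of_nonneg_left hφΨsqrt (by positivity)) (by positivity)
        (Real.exp_nonneg _)
    calc D s ≤ Real.exp (-A s) * (2 * R s * Real.sqrt (Ψ s)) := hstep1.trans hstep2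
      _ = 2 * Real.sqrt (χ s) * R s := by rw [hsqrt]; ring
  -- the comparison lemma on `[0, t]`
  have hRi : IntervalIntegrable R volume 0 t := hRc'.intervalIntegrable_of_Icc h0.le
  have hcmp := Torus.sqrt_le_sqrt_add_integral_of_hasDerivWithinAt h0.le hχd hDc hχ0
    hDle (fun s hs => hR0 s (hsub hs)) hRi
  -- unwind: `χ 0 = φ 0`, `√φ t ≤ √Ψ t = e^{A t} √χ t`
  have hχzero : χ 0 = φ 0 := by
    rw [hχs, hAs, hΨs, intervalIntegral.integral_same, intervalIntegral.integral_same]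
    simp
  have hsqrtΨ : Real.sqrt (Ψ t) = Real.exp (A t) * Real.sqrt (χ t) := by
    rw [hχs, Real.sqrt_mul (Real.exp_nonneg _), ← mul_assoc]
    have : Real.exp (A t) * Real.sqrt (Real.exp (-2 * A t)) = 1 := by
      rw [show -2 * A t = -A t + -A t by ring, Real.exp_add, Real.sqrt_mul_self (Real.exp_nonneg _),
        ← Real.exp_add, add_neg_cancel, Real.exp_zero]
    rw [this, one_mul]
  have htmem : t ∈ Icc 0 t := ⟨h0.le, le_rfl⟩
  calc Real.sqrt (φ t) ≤ Real.sqrt (Ψ t) := Real.sqrt_le_sqrt (hφΨ t htmem)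
    _ = Real.exp (A t) * Real.sqrt (χ t) := hsqrtΨ
    _ ≤ Real.exp (A t) * (Real.sqrt (χ 0) + ∫ s in (0 : ℝ)..t, R s) :=
        mul_le_mul_of_nonneg_left hcmp (Real.exp_nonneg _)
    _ = (Real.sqrt (φ 0) + ∫ s in (0 : ℝ)..t, R s) * Real.exp (∫ s in (0 : ℝ)..t, G s) := by
        rw [hχzero, hAs, mul_comm]

end Real

/-! ### The slab: balance, slice bound, and the strain-rate stability theorem -/

section Slab

set_option maxHeartbeats 800000 in
/-- **The `L²` balance of the difference of two classical solutions with different forces, with the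
strain-rate production bound** (the bookkeeping core of `l2_stability_strain_forced`). For classical
solutions `(u, p)` (force `f`) and `(u', p')` (force `f'`) on `[0, T] × ℝ³` (same `ν > 0`) in the
`L²`-Sobolev class, with force slices in `L²`, `−⟪ξ, Du'(t,x) ξ⟫ ≤ G(t)‖ξ‖²` and
`∫‖f(t) − f'(t)‖² ≤ R(t)²` (`R ≥ 0`): with `E(t) = ∫‖u(t) − u'(t)‖²` and
`Φ(t) = ∫ 2⟪u − u', ∂ₜu − ∂ₜu'⟫`, (a) `E` is continuous on `[0, T]`; (b) `Φ` is integrable on `(0, T)`;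
(c) `E(b) = E(0) + ∫₀ᵇ Φ`; (d) `Φ(t) + 2ν∫|∇(u − u')(t)|²_F ≤ 2G(t)E(t) + 2R(t)√E(t)` (the slice
identity `l2_slice_strain` with `Wᵢ = ∂ₜuᵢ − fᵢ`, plus Cauchy–Schwarz for `2∫⟪u − u', f − f'⟫`);
(e) the enstrophy of the difference is continuous on `[0, T]` (`IsSmoothSpaceTimeOn.enstrophy_balance`).
[cite: RobinsonRodrigoSadowski2016, Thm. 6.10 (proof), (6.3)] -/
theorem l2_strain_balance_forced {ν T : ℝ} (hT : 0 < T)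
    {f f' : ℝ → EuclideanSpace ℝ (Fin 3) → EuclideanSpace ℝ (Fin 3)}
    {u u' : ℝ → EuclideanSpace ℝ (Fin 3) → EuclideanSpace ℝ (Fin 3)}
    {p p' : ℝ → EuclideanSpace ℝ (Fin 3) → ℝ}
    (hsol : FluidPDE.IsClassicalNSSolutionOn (Icc 0 T) ν f u p)
    (hsol' : FluidPDE.IsClassicalNSSolutionOn (Icc 0 T) ν f' u' p')
    (hfL2 : ∀ t ∈ Icc 0 T, ∫⁻ x, ‖f t x‖ₑ ^ 2 < ⊤) (hf'L2 : ∀ t ∈ Icc 0 T, ∫⁻ x, ‖f' t x‖ₑ ^ 2 < ⊤)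
    (hu : HasBoundedSobolevNormsOn (Icc 0 T) u)
    (hut : HasBoundedSobolevNormsOn (Icc 0 T) (FluidPDE.timeDerivWithin (Icc 0 T) u))
    (hp : ∀ n : ℕ, ∃ C' : ℝ≥0, ∀ t ∈ Icc 0 T, ∫⁻ x, ‖iteratedFDeriv ℝ n (p t) x‖ₑ ^ 2 ≤ C')
    (hu' : HasBoundedSobolevNormsOn (Icc 0 T) u')
    (hut' : HasBoundedSobolevNormsOn (Icc 0 T) (FluidPDE.timeDerivWithin (Icc 0 T) u'))
    (hp' : ∀ n : ℕ, ∃ C' : ℝ≥0, ∀ t ∈ Icc 0 T, ∫⁻ x, ‖iteratedFDeriv ℝ n (p' t) x‖ₑ ^ 2 ≤ C')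
    {G R : ℝ → ℝ} (hR0 : ∀ t ∈ Icc 0 T, 0 ≤ R t)
    (hG : ∀ t ∈ Icc 0 T, ∀ x ξ, -⟪ξ, fderiv ℝ (u' t) x ξ⟫ ≤ G t * ‖ξ‖ ^ 2)
    (hR : ∀ t ∈ Icc 0 T, ∫ x, ‖f t x - f' t x‖ ^ 2 ≤ R t ^ 2) :
    ContinuousOn (fun t => ∫ x, ‖u t x - u' t x‖ ^ 2) (Icc 0 T) ∧
    IntegrableOn (fun t => ∫ x, 2 * ⟪u t x - u' t x,
        FluidPDE.timeDerivWithin (Icc 0 T) u t x - FluidPDE.timeDerivWithin (Icc 0 T) u' t x⟫)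
      (Ioo 0 T) ∧
    (∀ b ∈ Ioc 0 T, ∫ x, ‖u b x - u' b x‖ ^ 2 = (∫ x, ‖u 0 x - u' 0 x‖ ^ 2) +
      ∫ t in (0 : ℝ)..b, ∫ x, 2 * ⟪u t x - u' t x,
        FluidPDE.timeDerivWithin (Icc 0 T) u t x - FluidPDE.timeDerivWithin (Icc 0 T) u' t x⟫) ∧
    (∀ t ∈ Icc 0 T, (∫ x, 2 * ⟪u t x - u' t x,
        FluidPDE.timeDerivWithin (Icc 0 T) u t x - FluidPDE.timeDerivWithin (Icc 0 T) u' t x⟫) +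
        2 * ν * (∫ x, FluidPDE.frobeniusNormSq (fderiv ℝ (fun y => u t y - u' t y) x)) ≤
      2 * G t * (∫ x, ‖u t x - u' t x‖ ^ 2) + 2 * R t * Real.sqrt (∫ x, ‖u t x - u' t x‖ ^ 2)) ∧
    ContinuousOn (fun t => ∫ x, FluidPDE.frobeniusNormSq (fderiv ℝ (fun y => u t y - u' t y) x))
      (Icc 0 T) := by
  have hU : UniqueDiffOn ℝ (Icc 0 T) := uniqueDiffOn_Icc hT
  -- the forces are jointly smooth (determined by the equations)
  have hfs : FluidPDE.IsSmoothSpaceTimeOn (Icc 0 T) f := hsol.isSmoothSpaceTimeOn_force hU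
  have hfs' : FluidPDE.IsSmoothSpaceTimeOn (Icc 0 T) f' := hsol'.isSmoothSpaceTimeOn_force hU
  -- the difference and its time derivative
  obtain ⟨w, hwdef⟩ : ∃ w : ℝ → EuclideanSpace ℝ (Fin 3) → EuclideanSpace ℝ (Fin 3),
      w = fun t x => u t x - u' t x := ⟨_, rfl⟩
  have hwtx : ∀ t x, w t x = u t x - u' t x := fun t x => by rw [hwdef]
  have hwt : ∀ t, w t = fun x => u t x - u' t x := fun t => by rw [hwdef]
  have hwsm : FluidPDE.IsSmoothSpaceTimeOn (Icc 0 T) w := by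
    rw [hwdef]; exact hsol.smooth_velocity.sub hsol'.smooth_velocity
  have hWt : ∀ t ∈ Icc 0 T, ∀ x, FluidPDE.timeDerivWithin (Icc 0 T) w t x =
      FluidPDE.timeDerivWithin (Icc 0 T) u t x - FluidPDE.timeDerivWithin (Icc 0 T) u' t x := by
    intro t ht x
    rw [hwdef]
    exact hsol.smooth_velocity.timeDerivWithin_fun_sub hsol'.smooth_velocity hU ht x
  have hWt' : ∀ t ∈ Icc 0 T, FluidPDE.timeDerivWithin (Icc 0 T) w t =
      fun x => FluidPDE.timeDerivWithin (Icc 0 T) u t x - FluidPDE.timeDerivWithin (Icc 0 T) u' t x :=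
    fun t ht => funext (hWt t ht)
  -- class bounds
  obtain ⟨B, hB⟩ := linfty_bound_of_hasBoundedSobolevNormsOn_holds
    (fun t ht => (hsol.contDiff_velocity ht).of_le (by norm_cast)) hu
  obtain ⟨B', hB'⟩ := linfty_bound_of_hasBoundedSobolevNormsOn_holds
    (fun t ht => (hsol'.contDiff_velocity ht).of_le (by norm_cast)) hu'
  obtain ⟨C₀, hC₀⟩ := hu 0
  obtain ⟨C₁, hC₁⟩ := hu 1
  obtain ⟨C₂, hC₂⟩ := hu 2
  obtain ⟨C₀', hC₀'⟩ := hu' 0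
  obtain ⟨C₁', hC₁'⟩ := hu' 1
  obtain ⟨C₂', hC₂'⟩ := hu' 2
  obtain ⟨E₀, hE₀⟩ := hut 0
  obtain ⟨E₁, hE₁⟩ := hut 1
  obtain ⟨E₀', hE₀'⟩ := hut' 0
  obtain ⟨E₁', hE₁'⟩ := hut' 1
  obtain ⟨P₀, hP₀⟩ := hp 0
  obtain ⟨P₁, hP₁⟩ := hp 1
  obtain ⟨P₀', hP₀'⟩ := hp' 0
  obtain ⟨P₁', hP₁'⟩ := hp' 1
  have hzero : ∀ {g : EuclideanSpace ℝ (Fin 3) → EuclideanSpace ℝ (Fin 3)} {C' : ℝ≥0},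
      (∫⁻ x, ‖iteratedFDeriv ℝ 0 g x‖ₑ ^ 2 ≤ C') → ∫⁻ x, ‖g x‖ₑ ^ 2 ≤ C' := by
    intro g C' h
    refine (le_of_eq (lintegral_congr fun x => ?_)).trans h
    rw [← ofReal_norm, ← ofReal_norm, norm_iteratedFDeriv_zero]
  have hzero' : ∀ {g : EuclideanSpace ℝ (Fin 3) → ℝ} {C' : ℝ≥0},
      (∫⁻ x, ‖iteratedFDeriv ℝ 0 g x‖ₑ ^ 2 ≤ C') → ∫⁻ x, ‖g x‖ₑ ^ 2 < ⊤ := by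
    intro g C' h
    refine lt_of_le_of_lt ((le_of_eq (lintegral_congr fun x => ?_)).trans h) ENNReal.coe_lt_top
    rw [← ofReal_norm, ← ofReal_norm, norm_iteratedFDeriv_zero]
  -- `L²` bounds for `w`, `∂ₜ w`, `D w`, `D ∂ₜ w`
  have hwL2 : ∀ t ∈ Icc 0 T, ∫⁻ x, ‖w t x‖ₑ ^ 2 ≤ (2 * C₀ + 2 * C₀' : ℝ≥0) := by
    intro t ht
    have h := lintegral_enorm_sq_sub_le (g := u' t) ((hsol.contDiff_velocity ht).continuous.aestronglyMeasurable)
      (μ := volume)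
    calc ∫⁻ x, ‖w t x‖ₑ ^ 2 = ∫⁻ x, ‖u t x - u' t x‖ₑ ^ 2 := lintegral_congr fun x => by rw [hwtx]
      _ ≤ 2 * (∫⁻ x, ‖u t x‖ₑ ^ 2) + 2 * ∫⁻ x, ‖u' t x‖ₑ ^ 2 := h
      _ ≤ 2 * (C₀ : ℝ≥0∞) + 2 * (C₀' : ℝ≥0∞) := by
          gcongr
          · exact hzero (hC₀ t ht)
          · exact hzero (hC₀' t ht)
      _ = ((2 * C₀ + 2 * C₀' : ℝ≥0) : ℝ≥0∞) := by push_cast; rfl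
  have hWL2 : ∀ t ∈ Icc 0 T, ∫⁻ x, ‖FluidPDE.timeDerivWithin (Icc 0 T) w t x‖ₑ ^ 2 ≤
      (2 * E₀ + 2 * E₀' : ℝ≥0) := by
    intro t ht
    have hsm := (hsol.smooth_velocity.timeDerivWithin hU).contDiff_slice ht
    have h := lintegral_enorm_sq_sub_le (g := FluidPDE.timeDerivWithin (Icc 0 T) u' t)
      (hsm.continuous.aestronglyMeasurable) (μ := volume)
    calc ∫⁻ x, ‖FluidPDE.timeDerivWithin (Icc 0 T) w t x‖ₑ ^ 2
        = ∫⁻ x, ‖FluidPDE.timeDerivWithin (Icc 0 T) u t x - FluidPDE.timeDerivWithin (Icc 0 T) u' t x‖ₑ ^ 2 :=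
          lintegral_congr fun x => by rw [hWt t ht]
      _ ≤ 2 * (∫⁻ x, ‖FluidPDE.timeDerivWithin (Icc 0 T) u t x‖ₑ ^ 2) +
          2 * ∫⁻ x, ‖FluidPDE.timeDerivWithin (Icc 0 T) u' t x‖ₑ ^ 2 := h
      _ ≤ 2 * (E₀ : ℝ≥0∞) + 2 * (E₀' : ℝ≥0∞) := by
          gcongr
          · exact hzero (hE₀ t ht)
          · exact hzero (hE₀' t ht)
      _ = ((2 * E₀ + 2 * E₀' : ℝ≥0) : ℝ≥0∞) := by push_cast; rfl
  have hDwL2 : ∀ t ∈ Icc 0 T, ∫⁻ x, ‖iteratedFDeriv ℝ 1 (w t) x‖ₑ ^ 2 ≤ (2 * C₁ + 2 * C₁' : ℝ≥0) := by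
    intro t ht
    have hcont : Continuous fun x => iteratedFDeriv ℝ 1 (u t) x :=
      (hsol.contDiff_velocity ht).continuous_iteratedFDeriv (by norm_cast)
    have h := lintegral_enorm_sq_sub_le (g := fun x => iteratedFDeriv ℝ 1 (u' t) x)
      hcont.aestronglyMeasurable (μ := volume)
    have heq : ∀ x, iteratedFDeriv ℝ 1 (w t) x = iteratedFDeriv ℝ 1 (u t) x - iteratedFDeriv ℝ 1 (u' t) x := by
      intro x
      rw [hwt t]
      exact fun_iteratedFDeriv_sub_apply ((hsol.contDiff_velocity ht).contDiffAt.of_le (by norm_cast))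
        ((hsol'.contDiff_velocity ht).contDiffAt.of_le (by norm_cast))
    calc ∫⁻ x, ‖iteratedFDeriv ℝ 1 (w t) x‖ₑ ^ 2
        = ∫⁻ x, ‖iteratedFDeriv ℝ 1 (u t) x - iteratedFDeriv ℝ 1 (u' t) x‖ₑ ^ 2 :=
          lintegral_congr fun x => by rw [heq]
      _ ≤ 2 * (∫⁻ x, ‖iteratedFDeriv ℝ 1 (u t) x‖ₑ ^ 2) + 2 * ∫⁻ x, ‖iteratedFDeriv ℝ 1 (u' t) x‖ₑ ^ 2 := h
      _ ≤ 2 * (C₁ : ℝ≥0∞) + 2 * (C₁' : ℝ≥0∞) := by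
          gcongr
          · exact hC₁ t ht
          · exact hC₁' t ht
      _ = ((2 * C₁ + 2 * C₁' : ℝ≥0) : ℝ≥0∞) := by push_cast; rfl
  have hDWL2 : ∀ t ∈ Icc 0 T,
      ∫⁻ x, ‖iteratedFDeriv ℝ 1 (FluidPDE.timeDerivWithin (Icc 0 T) w t) x‖ₑ ^ 2 ≤ (2 * E₁ + 2 * E₁' : ℝ≥0) := by
    intro t ht
    have hsm := (hsol.smooth_velocity.timeDerivWithin hU).contDiff_slice ht
    have hsm' := (hsol'.smooth_velocity.timeDerivWithin hU).contDiff_slice ht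
    have hcont : Continuous fun x => iteratedFDeriv ℝ 1 (FluidPDE.timeDerivWithin (Icc 0 T) u t) x :=
      hsm.continuous_iteratedFDeriv (by norm_cast)
    have h := lintegral_enorm_sq_sub_le
      (g := fun x => iteratedFDeriv ℝ 1 (FluidPDE.timeDerivWithin (Icc 0 T) u' t) x)
      hcont.aestronglyMeasurable (μ := volume)
    have heq : ∀ x, iteratedFDeriv ℝ 1 (FluidPDE.timeDerivWithin (Icc 0 T) w t) x =
        iteratedFDeriv ℝ 1 (FluidPDE.timeDerivWithin (Icc 0 T) u t) x -
          iteratedFDeriv ℝ 1 (FluidPDE.timeDerivWithin (Icc 0 T) u' t) x := by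
      intro x
      rw [hWt' t ht]
      exact fun_iteratedFDeriv_sub_apply (hsm.contDiffAt.of_le (by norm_cast))
        (hsm'.contDiffAt.of_le (by norm_cast))
    calc ∫⁻ x, ‖iteratedFDeriv ℝ 1 (FluidPDE.timeDerivWithin (Icc 0 T) w t) x‖ₑ ^ 2
        = ∫⁻ x, ‖iteratedFDeriv ℝ 1 (FluidPDE.timeDerivWithin (Icc 0 T) u t) x -
            iteratedFDeriv ℝ 1 (FluidPDE.timeDerivWithin (Icc 0 T) u' t) x‖ₑ ^ 2 :=
          lintegral_congr fun x => by rw [heq]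
      _ ≤ 2 * (∫⁻ x, ‖iteratedFDeriv ℝ 1 (FluidPDE.timeDerivWithin (Icc 0 T) u t) x‖ₑ ^ 2) +
          2 * ∫⁻ x, ‖iteratedFDeriv ℝ 1 (FluidPDE.timeDerivWithin (Icc 0 T) u' t) x‖ₑ ^ 2 := h
      _ ≤ 2 * (E₁ : ℝ≥0∞) + 2 * (E₁' : ℝ≥0∞) := by
          gcongr
          · exact hE₁ t ht
          · exact hE₁' t ht
      _ = ((2 * E₁ + 2 * E₁' : ℝ≥0) : ℝ≥0∞) := by push_cast; rfl
  -- the balances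
  obtain ⟨hΦint, hEcont, hEb⟩ := hwsm.l2_balance hT hwL2 hWL2
  obtain ⟨-, hDFcont, -⟩ := hwsm.enstrophy_balance hT hDwL2 hDWL2
  -- the slice inequality at each time
  have hslab : ∀ t ∈ Icc 0 T, (∫ x, 2 * ⟪w t x, FluidPDE.timeDerivWithin (Icc 0 T) w t x⟫) +
        2 * ν * (∫ x, FluidPDE.frobeniusNormSq (fderiv ℝ (fun y => u t y - u' t y) x)) ≤
      2 * G t * (∫ x, ‖u t x - u' t x‖ ^ 2) + 2 * R t * Real.sqrt (∫ x, ‖u t x - u' t x‖ ^ 2) := by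
    intro t ht
    set Bm : ℝ := max B B' with hBm
    -- the reduced accelerations `Wᵢ := ∂ₜuᵢ(t) − fᵢ(t)`
    obtain ⟨W₁, hW₁def⟩ : ∃ W₁ : EuclideanSpace ℝ (Fin 3) → EuclideanSpace ℝ (Fin 3),
        W₁ = fun x => FluidPDE.timeDerivWithin (Icc 0 T) u t x - f t x := ⟨_, rfl⟩
    obtain ⟨W₂, hW₂def⟩ : ∃ W₂ : EuclideanSpace ℝ (Fin 3) → EuclideanSpace ℝ (Fin 3),
        W₂ = fun x => FluidPDE.timeDerivWithin (Icc 0 T) u' t x - f' t x := ⟨_, rfl⟩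
    have hW₁x : ∀ x, W₁ x = FluidPDE.timeDerivWithin (Icc 0 T) u t x - f t x := fun x => by
      rw [hW₁def]
    have hW₂x : ∀ x, W₂ x = FluidPDE.timeDerivWithin (Icc 0 T) u' t x - f' t x := fun x => by
      rw [hW₂def]
    have hft : ContDiff ℝ ∞ (f t) := hfs.contDiff_slice ht
    have hf't : ContDiff ℝ ∞ (f' t) := hfs'.contDiff_slice ht
    have hW₁c : ContDiff ℝ 1 W₁ := by
      rw [hW₁def]
      exact (((hsol.smooth_velocity.timeDerivWithin hU).contDiff_slice ht).sub hft).of_le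
        (by norm_cast)
    have hW₂c : ContDiff ℝ 1 W₂ := by
      rw [hW₂def]
      exact (((hsol'.smooth_velocity.timeDerivWithin hU).contDiff_slice ht).sub hf't).of_le
        (by norm_cast)
    have hmom : ∀ x, W₁ x + FluidPDE.convect (u t) (u t) x = ν • (Δ (u t)) x - gradient (p t) x := by
      intro x
      have h := hsol.momentum t ht x
      rw [hW₁x, sub_add_eq_add_sub, h, add_sub_cancel_right]
    have hmom' : ∀ x, W₂ x + FluidPDE.convect (u' t) (u' t) x =
        ν • (Δ (u' t)) x - gradient (p' t) x := by
      intro x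
      have h := hsol'.momentum t ht x
      rw [hW₂x, sub_add_eq_add_sub, h, add_sub_cancel_right]
    have hW₁L2 : ∫⁻ x, ‖W₁ x‖ₑ ^ 2 < ⊤ := by
      have hsm := (hsol.smooth_velocity.timeDerivWithin hU).contDiff_slice ht
      have h := lintegral_enorm_sq_sub_le (g := f t) (hsm.continuous.aestronglyMeasurable)
        (μ := volume) (f := FluidPDE.timeDerivWithin (Icc 0 T) u t)
      calc ∫⁻ x, ‖W₁ x‖ₑ ^ 2 = ∫⁻ x, ‖FluidPDE.timeDerivWithin (Icc 0 T) u t x - f t x‖ₑ ^ 2 :=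
            lintegral_congr fun x => by rw [hW₁x]
        _ ≤ 2 * (∫⁻ x, ‖FluidPDE.timeDerivWithin (Icc 0 T) u t x‖ₑ ^ 2) + 2 * ∫⁻ x, ‖f t x‖ₑ ^ 2 := h
        _ < ⊤ := by
            refine ENNReal.add_lt_top.2 ⟨ENNReal.mul_lt_top (by simp) ?_, ENNReal.mul_lt_top (by simp) (hfL2 t ht)⟩
            exact (hzero (hE₀ t ht)).trans_lt ENNReal.coe_lt_top
    have hW₂L2 : ∫⁻ x, ‖W₂ x‖ₑ ^ 2 < ⊤ := by
      have hsm := (hsol'.smooth_velocity.timeDerivWithin hU).contDiff_slice ht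
      have h := lintegral_enorm_sq_sub_le (g := f' t) (hsm.continuous.aestronglyMeasurable)
        (μ := volume) (f := FluidPDE.timeDerivWithin (Icc 0 T) u' t)
      calc ∫⁻ x, ‖W₂ x‖ₑ ^ 2 = ∫⁻ x, ‖FluidPDE.timeDerivWithin (Icc 0 T) u' t x - f' t x‖ₑ ^ 2 :=
            lintegral_congr fun x => by rw [hW₂x]
        _ ≤ 2 * (∫⁻ x, ‖FluidPDE.timeDerivWithin (Icc 0 T) u' t x‖ₑ ^ 2) + 2 * ∫⁻ x, ‖f' t x‖ₑ ^ 2 := h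
        _ < ⊤ := by
            refine ENNReal.add_lt_top.2 ⟨ENNReal.mul_lt_top (by simp) ?_, ENNReal.mul_lt_top (by simp) (hf'L2 t ht)⟩
            exact (hzero (hE₀' t ht)).trans_lt ENNReal.coe_lt_top
    have hsl := l2_slice_strain ((hsol.contDiff_velocity ht).of_le (by norm_cast))
      ((hsol'.contDiff_velocity ht).of_le (by norm_cast)) hW₁c hW₂c
      ((hsol.contDiff_pressure ht).of_le (by norm_cast)) ((hsol'.contDiff_pressure ht).of_le (by norm_cast))
      hmom hmom' (hsol.divFree t ht) (hsol'.divFree t ht)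
      (fun x => (hB t ht x).trans (le_max_left B B')) (fun x => (hB' t ht x).trans (le_max_right B B'))
      ((hzero (hC₀ t ht)).trans_lt ENNReal.coe_lt_top) ((hC₁ t ht).trans_lt ENNReal.coe_lt_top)
      ((hC₂ t ht).trans_lt ENNReal.coe_lt_top)
      ((hzero (hC₀' t ht)).trans_lt ENNReal.coe_lt_top) ((hC₁' t ht).trans_lt ENNReal.coe_lt_top)
      ((hC₂' t ht).trans_lt ENNReal.coe_lt_top)
      hW₁L2 hW₂L2
      (hzero' (hP₀ t ht)) ((hP₁ t ht).trans_lt ENNReal.coe_lt_top)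
      (hzero' (hP₀' t ht)) ((hP₁' t ht).trans_lt ENNReal.coe_lt_top) (hG t ht)
    -- the forces do NOT cancel: `∂ₜu − ∂ₜu' = (W₁ − W₂) + (f − f')`
    have hWW : ∀ x, FluidPDE.timeDerivWithin (Icc 0 T) u t x - FluidPDE.timeDerivWithin (Icc 0 T) u' t x =
        (W₁ x - W₂ x) + (f t x - f' t x) := fun x => by
      rw [hW₁x, hW₂x]; abel
    -- continuity and square integrability of the slices `u t − u' t`, `W₁ − W₂`, `f t − f' t`
    have cw : Continuous (w t) := (hwsm.contDiff_slice ht).continuous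
    have cW : Continuous fun x => W₁ x - W₂ x := (hW₁c.sub hW₂c).continuous
    have cg : Continuous fun x => f t x - f' t x := (hft.sub hf't).continuous
    have l2w : ∫⁻ x, ‖w t x‖ₑ ^ 2 < ⊤ := (hwL2 t ht).trans_lt ENNReal.coe_lt_top
    have l2W : ∫⁻ x, ‖W₁ x - W₂ x‖ₑ ^ 2 < ⊤ :=
      lintegral_enorm_sq_lt_top_of_norm_le_add (fun x => norm_sub_le _ _)
        hW₁c.continuous.aestronglyMeasurable hW₁L2 hW₂L2
    have l2g : ∫⁻ x, ‖f t x - f' t x‖ₑ ^ 2 < ⊤ :=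
      lintegral_enorm_sq_lt_top_of_norm_le_add (fun x => norm_sub_le _ _)
        hft.continuous.aestronglyMeasurable (hfL2 t ht) (hf'L2 t ht)
    have iW : Integrable (fun x => ⟪w t x, W₁ x - W₂ x⟫) volume :=
      integrable_of_norm_le_mul_of_lintegral_sq (cw.inner cW).aestronglyMeasurable cw cW l2w l2W
        fun x => norm_inner_le_norm _ _
    have ig : Integrable (fun x => ⟪w t x, f t x - f' t x⟫) volume :=
      integrable_of_norm_le_mul_of_lintegral_sq (cw.inner cg).aestronglyMeasurable cw cg l2w l2g
        fun x => norm_inner_le_norm _ _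
    -- `Φ t = 2 ∫ ⟪w, W₁ − W₂⟫ + 2 ∫ ⟪w, f − f'⟫`
    have hΦeq : (∫ x, 2 * ⟪w t x, FluidPDE.timeDerivWithin (Icc 0 T) w t x⟫) =
        2 * (∫ x, ⟪u t x - u' t x, W₁ x - W₂ x⟫) + 2 * ∫ x, ⟪w t x, f t x - f' t x⟫ := by
      rw [integral_const_mul]
      have h1 : ∫ x, ⟪w t x, FluidPDE.timeDerivWithin (Icc 0 T) w t x⟫ =
          ∫ x, (⟪w t x, W₁ x - W₂ x⟫ + ⟪w t x, f t x - f' t x⟫) :=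
        integral_congr_ae (Eventually.of_forall fun x => by
          simp only [hWt t ht, hWW, inner_add_right])
      have h2 : ∫ x, ⟪u t x - u' t x, W₁ x - W₂ x⟫ = ∫ x, ⟪w t x, W₁ x - W₂ x⟫ :=
        integral_congr_ae (Eventually.of_forall fun x => by simp only [hwtx])
      rw [h1, integral_add iW ig, h2]
      ring
    -- Cauchy–Schwarz for the force pairing
    have hwm : MemLp (w t) 2 volume :=
      ⟨cw.aestronglyMeasurable, eLpNorm_two_lt_top_of_lintegral_enorm_sq_lt_top l2w⟩
    have hgm : MemLp (fun x => f t x - f' t x) 2 volume :=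
      ⟨cg.aestronglyMeasurable, eLpNorm_two_lt_top_of_lintegral_enorm_sq_lt_top l2g⟩
    have hCS : ∫ x, ⟪w t x, f t x - f' t x⟫ ≤
        Real.sqrt (∫ x, ‖u t x - u' t x‖ ^ 2) * R t := by
      have h1 : ∫ x, ⟪w t x, f t x - f' t x⟫ ≤ ∫ x, ‖w t x‖ * ‖f t x - f' t x‖ :=
        integral_mono ig (by
            have := integral_norm_mul_norm_le_sqrt_mul_sqrt hwm hgm
            exact integrable_of_norm_le_mul_of_lintegral_sq
              ((cw.norm.mul cg.norm).aestronglyMeasurable) cw cg l2w l2g fun x => by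
                rw [Real.norm_of_nonneg (mul_nonneg (norm_nonneg _) (norm_nonneg _))])
          fun x => real_inner_le_norm _ _
      have h2 := integral_norm_mul_norm_le_sqrt_mul_sqrt hwm hgm
      have h3 : Real.sqrt (∫ x, ‖f t x - f' t x‖ ^ 2) ≤ R t := by
        calc Real.sqrt (∫ x, ‖f t x - f' t x‖ ^ 2) ≤ Real.sqrt (R t ^ 2) := Real.sqrt_le_sqrt (hR t ht)
          _ = R t := Real.sqrt_sq (hR0 t ht)
      have h4 : Real.sqrt (∫ x, ‖w t x‖ ^ 2) = Real.sqrt (∫ x, ‖u t x - u' t x‖ ^ 2) := by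
        congr 1; exact integral_congr_ae (Eventually.of_forall fun x => by simp only [hwtx])
      calc ∫ x, ⟪w t x, f t x - f' t x⟫ ≤ ∫ x, ‖w t x‖ * ‖f t x - f' t x‖ := h1
        _ ≤ Real.sqrt (∫ x, ‖w t x‖ ^ 2) * Real.sqrt (∫ x, ‖f t x - f' t x‖ ^ 2) := h2
        _ ≤ Real.sqrt (∫ x, ‖u t x - u' t x‖ ^ 2) * R t := by
            rw [h4]; exact mul_le_mul_of_nonneg_left h3 (Real.sqrt_nonneg _)
    rw [hΦeq]
    nlinarith [hsl, hCS]
  refine ⟨?_, ?_, ?_, ?_, ?_⟩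
  · refine hEcont.congr fun t _ => ?_
    exact integral_congr_ae (Eventually.of_forall fun x => by simp only [hwtx])
  · refine hΦint.congr_fun (fun t ht => ?_) measurableSet_Ioo
    exact integral_congr_ae (Eventually.of_forall fun x => by
      simp only [hwtx, hWt t (Ioo_subset_Icc_self ht)])
  · intro b hb
    have h := hEb b hb
    have e1 : ∫ x, ‖w b x‖ ^ 2 = ∫ x, ‖u b x - u' b x‖ ^ 2 :=
      integral_congr_ae (Eventually.of_forall fun x => by simp only [hwtx])
    have e0 : ∫ x, ‖w 0 x‖ ^ 2 = ∫ x, ‖u 0 x - u' 0 x‖ ^ 2 :=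
      integral_congr_ae (Eventually.of_forall fun x => by simp only [hwtx])
    rw [e1, e0] at h
    rw [h]
    congr 1
    refine intervalIntegral.integral_congr fun t ht => ?_
    have ht' : t ∈ Icc 0 T := by
      rw [uIcc_of_le hb.1.le] at ht
      exact ⟨ht.1, ht.2.trans hb.2⟩
    exact integral_congr_ae (Eventually.of_forall fun x => by simp only [hwtx, hWt t ht'])
  · intro t ht
    have h := hslab t ht
    have e : (∫ x, 2 * ⟪w t x, FluidPDE.timeDerivWithin (Icc 0 T) w t x⟫) =
        ∫ x, 2 * ⟪u t x - u' t x,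
          FluidPDE.timeDerivWithin (Icc 0 T) u t x - FluidPDE.timeDerivWithin (Icc 0 T) u' t x⟫ :=
      integral_congr_ae (Eventually.of_forall fun x => by simp only [hwtx, hWt t ht])
    rw [e] at h
    exact h
  · refine hDFcont.congr fun t _ => ?_
    exact integral_congr_ae (Eventually.of_forall fun x => by simp only [hwt t])


/-- **`L²` stability with the strain rate (dissipation-aware shadowing), forced, on a slab.** Let
`(u, p)` (force `f`) and `(u', p')` (force `f'`) be classical solutions of the Navier–Stokes system
with the same viscosity `ν > 0` on `[0, T] × ℝ³`, both with `u, ∂ₜu, p ∈ L^∞_t H^k_x` for all `k`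
and with force slices in `L²`. Let `G, R ≥ 0` be continuous on `[0, T]` with
`−⟪ξ, Du'(t, x) ξ⟫ ≤ G(t)‖ξ‖²` for all `x, ξ` (e.g. `G(t) = sup_x λ_max(−sym Du'(t,x))`, the maximal
compression rate of the reference `u'`) and `∫‖f(t) − f'(t)‖² ≤ R(t)²`. Then for all `t ∈ [0, T]`

`‖u(t) − u'(t)‖_{L²} ≤ (‖u(0) − u'(0)‖_{L²} + ∫₀ᵗ R) · exp(∫₀ᵗ G)`.

No Sobolev constant and no unknown absolute constant enter: the transport by `u` and the pressure
vanish exactly, the stretching is bounded pointwise (`l2_strain_balance_forced`), and the square-root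
Grönwall lemma `sqrt_le_mul_exp_of_le_add_intervalIntegral` integrates the balance.
[cite: RobinsonRodrigoSadowski2016, Thm. 6.10 (proof), (6.3); Thm. 9.1]
[cite: DashtiRobinson2008, Thm. 1] -/
theorem l2_stability_strain_forced {ν T : ℝ} (hν : 0 < ν) (hT : 0 < T)
    {f f' : ℝ → EuclideanSpace ℝ (Fin 3) → EuclideanSpace ℝ (Fin 3)}
    {u u' : ℝ → EuclideanSpace ℝ (Fin 3) → EuclideanSpace ℝ (Fin 3)}
    {p p' : ℝ → EuclideanSpace ℝ (Fin 3) → ℝ}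
    (hsol : FluidPDE.IsClassicalNSSolutionOn (Icc 0 T) ν f u p)
    (hsol' : FluidPDE.IsClassicalNSSolutionOn (Icc 0 T) ν f' u' p')
    (hfL2 : ∀ t ∈ Icc 0 T, ∫⁻ x, ‖f t x‖ₑ ^ 2 < ⊤) (hf'L2 : ∀ t ∈ Icc 0 T, ∫⁻ x, ‖f' t x‖ₑ ^ 2 < ⊤)
    (hu : HasBoundedSobolevNormsOn (Icc 0 T) u)
    (hut : HasBoundedSobolevNormsOn (Icc 0 T) (FluidPDE.timeDerivWithin (Icc 0 T) u))
    (hp : ∀ n : ℕ, ∃ C' : ℝ≥0, ∀ t ∈ Icc 0 T, ∫⁻ x, ‖iteratedFDeriv ℝ n (p t) x‖ₑ ^ 2 ≤ C')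
    (hu' : HasBoundedSobolevNormsOn (Icc 0 T) u')
    (hut' : HasBoundedSobolevNormsOn (Icc 0 T) (FluidPDE.timeDerivWithin (Icc 0 T) u'))
    (hp' : ∀ n : ℕ, ∃ C' : ℝ≥0, ∀ t ∈ Icc 0 T, ∫⁻ x, ‖iteratedFDeriv ℝ n (p' t) x‖ₑ ^ 2 ≤ C')
    {G R : ℝ → ℝ} (hGc : ContinuousOn G (Icc 0 T)) (hRc : ContinuousOn R (Icc 0 T))
    (hG0 : ∀ t ∈ Icc 0 T, 0 ≤ G t) (hR0 : ∀ t ∈ Icc 0 T, 0 ≤ R t)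
    (hG : ∀ t ∈ Icc 0 T, ∀ x ξ, -⟪ξ, fderiv ℝ (u' t) x ξ⟫ ≤ G t * ‖ξ‖ ^ 2)
    (hR : ∀ t ∈ Icc 0 T, ∫ x, ‖f t x - f' t x‖ ^ 2 ≤ R t ^ 2) :
    ∀ t ∈ Icc 0 T, Real.sqrt (∫ x, ‖u t x - u' t x‖ ^ 2) ≤
      (Real.sqrt (∫ x, ‖u 0 x - u' 0 x‖ ^ 2) + ∫ s in (0 : ℝ)..t, R s) *
        Real.exp (∫ s in (0 : ℝ)..t, G s) := by
  obtain ⟨hEc, hΦi, hEb, hsl, -⟩ := l2_strain_balance_forced hT hsol hsol' hfL2 hf'L2 hu hut hp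
    hu' hut' hp' hR0 hG hR
  -- names
  obtain ⟨E, hEdef⟩ : ∃ E : ℝ → ℝ, E = fun t => ∫ x, ‖u t x - u' t x‖ ^ 2 := ⟨_, rfl⟩
  have hEt : ∀ t, E t = ∫ x, ‖u t x - u' t x‖ ^ 2 := fun t => by rw [hEdef]
  obtain ⟨Φ, hΦdef⟩ : ∃ Φ : ℝ → ℝ, Φ = fun t => ∫ x, 2 * ⟪u t x - u' t x,
      FluidPDE.timeDerivWithin (Icc 0 T) u t x - FluidPDE.timeDerivWithin (Icc 0 T) u' t x⟫ :=
    ⟨_, rfl⟩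
  have hΦt : ∀ t, Φ t = ∫ x, 2 * ⟪u t x - u' t x,
      FluidPDE.timeDerivWithin (Icc 0 T) u t x - FluidPDE.timeDerivWithin (Icc 0 T) u' t x⟫ :=
    fun t => by rw [hΦdef]
  rw [← hEdef] at hEc
  rw [← hΦdef] at hΦi
  have hE0 : ∀ t, 0 ≤ E t := fun t => by rw [hEt]; exact integral_nonneg fun x => sq_nonneg _
  -- the slice bound without the dissipation: `Φ ≤ 2 G E + 2 R √E`
  have hslab : ∀ t ∈ Icc 0 T, Φ t ≤ 2 * G t * E t + 2 * R t * Real.sqrt (E t) := by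
    intro t ht
    have h := hsl t ht
    rw [← hΦt, ← hEt] at h
    have hDF : 0 ≤ ∫ x, FluidPDE.frobeniusNormSq (fderiv ℝ (fun y => u t y - u' t y) x) :=
      integral_nonneg fun x => FluidPDE.frobeniusNormSq_nonneg _
    nlinarith [h, hDF, hν]
  -- the integral inequality
  have hkc : ContinuousOn (fun s => 2 * G s * E s + 2 * R s * Real.sqrt (E s)) (Icc 0 T) :=
    ((continuousOn_const.mul hGc).mul hEc).add ((continuousOn_const.mul hRc).mul hEc.sqrt)
  have hle : ∀ t ∈ Icc 0 T,
      E t ≤ E 0 + ∫ s in (0 : ℝ)..t, (2 * G s * E s + 2 * R s * Real.sqrt (E s)) := by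
    intro t ht
    rcases eq_or_lt_of_le ht.1 with h0 | h0
    · rw [← h0, intervalIntegral.integral_same, add_zero]
    have hΦii : IntervalIntegrable Φ volume 0 t :=
      (intervalIntegrable_iff_integrableOn_Ioo_of_le h0.le).2
        (hΦi.mono_set (Ioo_subset_Ioo le_rfl ht.2))
    have hkc' : ContinuousOn (fun s => 2 * G s * E s + 2 * R s * Real.sqrt (E s)) (Icc 0 t) :=
      hkc.mono (Icc_subset_Icc le_rfl ht.2)
    have hmono : ∫ s in (0 : ℝ)..t, Φ s ≤
        ∫ s in (0 : ℝ)..t, (2 * G s * E s + 2 * R s * Real.sqrt (E s)) :=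
      intervalIntegral.integral_mono_on h0.le hΦii (hkc'.intervalIntegrable_of_Icc h0.le)
        fun s hs => hslab s ⟨hs.1, hs.2.trans ht.2⟩
    have hb := hEb t ⟨h0, ht.2⟩
    rw [← hEt, ← hEt] at hb
    have hb' : E t = E 0 + ∫ s in (0 : ℝ)..t, Φ s := by
      rw [hb]; congr 1
      exact intervalIntegral.integral_congr fun s _ => (hΦt s).symm
    linarith
  have hmain := sqrt_le_mul_exp_of_le_add_intervalIntegral hEc (fun t _ => hE0 t) hGc hRc hG0
    hR0 hle
  intro t ht
  have h := hmain t ht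
  rw [hEt, hEt] at h
  exact h

/-- **Constant-rate form** of `l2_stability_strain_forced` (the shape a certificate consumes): with
constants `G ≥ sup_{t,x} λ_max(−sym Du'(t,x))` and `R ≥ sup_t ‖f(t) − f'(t)‖_{L²}`,
`‖u(t) − u'(t)‖_{L²} ≤ (‖u(0) − u'(0)‖_{L²} + R t) · e^{G t}` on `[0, T]`.
[cite: RobinsonRodrigoSadowski2016, Thm. 6.10 (proof), (6.3)] -/
theorem l2_stability_strain_forced_const {ν T : ℝ} (hν : 0 < ν) (hT : 0 < T)
    {f f' : ℝ → EuclideanSpace ℝ (Fin 3) → EuclideanSpace ℝ (Fin 3)}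
    {u u' : ℝ → EuclideanSpace ℝ (Fin 3) → EuclideanSpace ℝ (Fin 3)}
    {p p' : ℝ → EuclideanSpace ℝ (Fin 3) → ℝ}
    (hsol : FluidPDE.IsClassicalNSSolutionOn (Icc 0 T) ν f u p)
    (hsol' : FluidPDE.IsClassicalNSSolutionOn (Icc 0 T) ν f' u' p')
    (hfL2 : ∀ t ∈ Icc 0 T, ∫⁻ x, ‖f t x‖ₑ ^ 2 < ⊤) (hf'L2 : ∀ t ∈ Icc 0 T, ∫⁻ x, ‖f' t x‖ₑ ^ 2 < ⊤)
    (hu : HasBoundedSobolevNormsOn (Icc 0 T) u)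
    (hut : HasBoundedSobolevNormsOn (Icc 0 T) (FluidPDE.timeDerivWithin (Icc 0 T) u))
    (hp : ∀ n : ℕ, ∃ C' : ℝ≥0, ∀ t ∈ Icc 0 T, ∫⁻ x, ‖iteratedFDeriv ℝ n (p t) x‖ₑ ^ 2 ≤ C')
    (hu' : HasBoundedSobolevNormsOn (Icc 0 T) u')
    (hut' : HasBoundedSobolevNormsOn (Icc 0 T) (FluidPDE.timeDerivWithin (Icc 0 T) u'))
    (hp' : ∀ n : ℕ, ∃ C' : ℝ≥0, ∀ t ∈ Icc 0 T, ∫⁻ x, ‖iteratedFDeriv ℝ n (p' t) x‖ₑ ^ 2 ≤ C')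
    {G R : ℝ} (hG0 : 0 ≤ G) (hR0 : 0 ≤ R)
    (hG : ∀ t ∈ Icc 0 T, ∀ x ξ, -⟪ξ, fderiv ℝ (u' t) x ξ⟫ ≤ G * ‖ξ‖ ^ 2)
    (hR : ∀ t ∈ Icc 0 T, ∫ x, ‖f t x - f' t x‖ ^ 2 ≤ R ^ 2) :
    ∀ t ∈ Icc 0 T, Real.sqrt (∫ x, ‖u t x - u' t x‖ ^ 2) ≤
      (Real.sqrt (∫ x, ‖u 0 x - u' 0 x‖ ^ 2) + R * t) * Real.exp (G * t) := by
  intro t ht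
  have h := l2_stability_strain_forced hν hT hsol hsol' hfL2 hf'L2 hu hut hp hu' hut' hp'
    (G := fun _ => G) (R := fun _ => R) continuousOn_const continuousOn_const (fun _ _ => hG0)
    (fun _ _ => hR0) hG hR t ht
  simp only [intervalIntegral.integral_const, sub_zero, smul_eq_mul] at h
  rw [mul_comm t R, mul_comm t G] at h
  exact h

/-- **The dissipation budget of the difference.** Under the hypotheses of
`l2_stability_strain_forced`, with `M(t) = (‖u(0) − u'(0)‖_{L²} + ∫₀ᵗ R) · exp(∫₀ᵗ G)`:
`‖u(t) − u'(t)‖²_{L²} + 2ν ∫₀ᵗ ‖∇(u − u')(s)‖²_{L²} ds ≤ M(t)²` — the energy balance integrated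
with the dissipation kept, the production bounded using `‖u(s) − u'(s)‖_{L²} ≤ M(s)`, and
`d/ds M² = 2 G M² + 2 R M e^{∫G} ≥ 2 G M² + 2 R M`. (The time-integrated `H¹`-smallness of the
difference that a subsequent parabolic-smoothing step consumes.)
[cite: RobinsonRodrigoSadowski2016, Thm. 6.10 (proof), (6.3)] -/
theorem l2_dissipation_strain_forced {ν T : ℝ} (hν : 0 < ν) (hT : 0 < T)
    {f f' : ℝ → EuclideanSpace ℝ (Fin 3) → EuclideanSpace ℝ (Fin 3)}
    {u u' : ℝ → EuclideanSpace ℝ (Fin 3) → EuclideanSpace ℝ (Fin 3)}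
    {p p' : ℝ → EuclideanSpace ℝ (Fin 3) → ℝ}
    (hsol : FluidPDE.IsClassicalNSSolutionOn (Icc 0 T) ν f u p)
    (hsol' : FluidPDE.IsClassicalNSSolutionOn (Icc 0 T) ν f' u' p')
    (hfL2 : ∀ t ∈ Icc 0 T, ∫⁻ x, ‖f t x‖ₑ ^ 2 < ⊤) (hf'L2 : ∀ t ∈ Icc 0 T, ∫⁻ x, ‖f' t x‖ₑ ^ 2 < ⊤)
    (hu : HasBoundedSobolevNormsOn (Icc 0 T) u)
    (hut : HasBoundedSobolevNormsOn (Icc 0 T) (FluidPDE.timeDerivWithin (Icc 0 T) u))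
    (hp : ∀ n : ℕ, ∃ C' : ℝ≥0, ∀ t ∈ Icc 0 T, ∫⁻ x, ‖iteratedFDeriv ℝ n (p t) x‖ₑ ^ 2 ≤ C')
    (hu' : HasBoundedSobolevNormsOn (Icc 0 T) u')
    (hut' : HasBoundedSobolevNormsOn (Icc 0 T) (FluidPDE.timeDerivWithin (Icc 0 T) u'))
    (hp' : ∀ n : ℕ, ∃ C' : ℝ≥0, ∀ t ∈ Icc 0 T, ∫⁻ x, ‖iteratedFDeriv ℝ n (p' t) x‖ₑ ^ 2 ≤ C')
    {G R : ℝ → ℝ} (hGc : ContinuousOn G (Icc 0 T)) (hRc : ContinuousOn R (Icc 0 T))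
    (hG0 : ∀ t ∈ Icc 0 T, 0 ≤ G t) (hR0 : ∀ t ∈ Icc 0 T, 0 ≤ R t)
    (hG : ∀ t ∈ Icc 0 T, ∀ x ξ, -⟪ξ, fderiv ℝ (u' t) x ξ⟫ ≤ G t * ‖ξ‖ ^ 2)
    (hR : ∀ t ∈ Icc 0 T, ∫ x, ‖f t x - f' t x‖ ^ 2 ≤ R t ^ 2) :
    ∀ t ∈ Icc 0 T, (∫ x, ‖u t x - u' t x‖ ^ 2) +
        2 * ν * ∫ s in (0 : ℝ)..t, ∫ x, FluidPDE.frobeniusNormSq (fderiv ℝ (fun y => u s y - u' s y) x) ≤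
      ((Real.sqrt (∫ x, ‖u 0 x - u' 0 x‖ ^ 2) + ∫ s in (0 : ℝ)..t, R s) *
        Real.exp (∫ s in (0 : ℝ)..t, G s)) ^ 2 := by
  have hstab := l2_stability_strain_forced hν hT hsol hsol' hfL2 hf'L2 hu hut hp hu' hut' hp' hGc hRc
    hG0 hR0 hG hR
  obtain ⟨hEc, hΦi, hEb, hsl, hDFc⟩ := l2_strain_balance_forced hT hsol hsol' hfL2 hf'L2 hu hut hp
    hu' hut' hp' hR0 hG hR
  -- names
  obtain ⟨E, hEdef⟩ : ∃ E : ℝ → ℝ, E = fun t => ∫ x, ‖u t x - u' t x‖ ^ 2 := ⟨_, rfl⟩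
  have hEt : ∀ t, E t = ∫ x, ‖u t x - u' t x‖ ^ 2 := fun t => by rw [hEdef]
  obtain ⟨Φ, hΦdef⟩ : ∃ Φ : ℝ → ℝ, Φ = fun t => ∫ x, 2 * ⟪u t x - u' t x,
      FluidPDE.timeDerivWithin (Icc 0 T) u t x - FluidPDE.timeDerivWithin (Icc 0 T) u' t x⟫ :=
    ⟨_, rfl⟩
  have hΦt : ∀ t, Φ t = ∫ x, 2 * ⟪u t x - u' t x,
      FluidPDE.timeDerivWithin (Icc 0 T) u t x - FluidPDE.timeDerivWithin (Icc 0 T) u' t x⟫ :=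
    fun t => by rw [hΦdef]
  obtain ⟨DF, hDFdef⟩ : ∃ DF : ℝ → ℝ,
      DF = fun t => ∫ x, FluidPDE.frobeniusNormSq (fderiv ℝ (fun y => u t y - u' t y) x) := ⟨_, rfl⟩
  have hDFt : ∀ t, DF t = ∫ x, FluidPDE.frobeniusNormSq (fderiv ℝ (fun y => u t y - u' t y) x) :=
    fun t => by rw [hDFdef]
  obtain ⟨M, hMdef⟩ : ∃ M : ℝ → ℝ, M = fun t =>
      (Real.sqrt (E 0) + ∫ s in (0 : ℝ)..t, R s) * Real.exp (∫ s in (0 : ℝ)..t, G s) := ⟨_, rfl⟩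
  have hMt : ∀ t, M t = (Real.sqrt (E 0) + ∫ s in (0 : ℝ)..t, R s) * Real.exp (∫ s in (0 : ℝ)..t, G s) :=
    fun t => by rw [hMdef]
  rw [← hEdef] at hEc
  rw [← hΦdef] at hΦi
  rw [← hDFdef] at hDFc
  have hE0 : ∀ t, 0 ≤ E t := fun t => by rw [hEt]; exact integral_nonneg fun x => sq_nonneg _
  have hDF0 : ∀ t, 0 ≤ DF t := fun t => by
    rw [hDFt]; exact integral_nonneg fun x => FluidPDE.frobeniusNormSq_nonneg _
  have hsqrtE : ∀ s ∈ Icc 0 T, Real.sqrt (E s) ≤ M s := by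
    intro s hs
    have h := hstab s hs
    rw [← hEt, ← hEt] at h
    rw [hMt]
    exact h
  have hM0 : ∀ s ∈ Icc 0 T, 0 ≤ M s := fun s hs => (Real.sqrt_nonneg _).trans (hsqrtE s hs)
  have hEM : ∀ s ∈ Icc 0 T, E s ≤ M s ^ 2 := by
    intro s hs
    have h := hsqrtE s hs
    have h2 : Real.sqrt (E s) ^ 2 ≤ M s ^ 2 := pow_le_pow_left₀ (Real.sqrt_nonneg _) h 2
    rwa [Real.sq_sqrt (hE0 s)] at h2
  -- the slice bound in names: `Φ + 2ν DF ≤ 2 G E + 2 R √E ≤ 2 G M² + 2 R M`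
  have hslab : ∀ s ∈ Icc 0 T, Φ s + 2 * ν * DF s ≤ 2 * G s * M s ^ 2 + 2 * R s * M s := by
    intro s hs
    have h := hsl s hs
    rw [← hΦt, ← hEt, ← hDFt] at h
    have h1 : 2 * G s * E s ≤ 2 * G s * M s ^ 2 :=
      mul_le_mul_of_nonneg_left (hEM s hs) (by linarith [hG0 s hs])
    have h2 : 2 * R s * Real.sqrt (E s) ≤ 2 * R s * M s :=
      mul_le_mul_of_nonneg_left (hsqrtE s hs) (by linarith [hR0 s hs])
    linarith
  intro t ht
  rcases eq_or_lt_of_le ht.1 with h0 | h0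
  · -- `t = 0`
    rw [← h0, intervalIntegral.integral_same, intervalIntegral.integral_same,
      intervalIntegral.integral_same, mul_zero, add_zero, add_zero, Real.exp_zero, mul_one,
      Real.sq_sqrt (integral_nonneg fun x => sq_nonneg _)]
  have hsub : Icc 0 t ⊆ Icc 0 T := Icc_subset_Icc le_rfl ht.2
  -- continuity on `[0, t]`
  have hGc' : ContinuousOn G (Icc 0 t) := hGc.mono hsub
  have hRc' : ContinuousOn R (Icc 0 t) := hRc.mono hsub
  have hDFc' : ContinuousOn DF (Icc 0 t) := hDFc.mono hsub
  -- `M` and `M²` are differentiable within `[0, t]`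
  have hprim : ∀ {g : ℝ → ℝ}, ContinuousOn g (Icc 0 t) → ∀ s ∈ Icc 0 t,
      HasDerivWithinAt (fun u => ∫ σ in (0 : ℝ)..u, g σ) (g s) (Icc 0 t) s := by
    intro g hg s hs
    haveI : Fact (s ∈ Icc 0 t) := ⟨hs⟩
    have hgi : IntervalIntegrable g volume 0 s :=
      (hg.mono (Icc_subset_Icc_right hs.2)).intervalIntegrable_of_Icc hs.1
    exact intervalIntegral.integral_hasDerivWithinAt_right hgi
      (hg.stronglyMeasurableAtFilter_nhdsWithin measurableSet_Icc s) (hg s hs)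
  obtain ⟨A, hA⟩ : ∃ A : ℝ → ℝ, A = fun s => ∫ σ in (0 : ℝ)..s, G σ := ⟨_, rfl⟩
  have hAs : ∀ s, A s = ∫ σ in (0 : ℝ)..s, G σ := fun s => by rw [hA]
  obtain ⟨Q, hQ⟩ : ∃ Q : ℝ → ℝ, Q = fun s => Real.sqrt (E 0) + ∫ σ in (0 : ℝ)..s, R σ := ⟨_, rfl⟩
  have hQs : ∀ s, Q s = Real.sqrt (E 0) + ∫ σ in (0 : ℝ)..s, R σ := fun s => by rw [hQ]
  have hMQA : ∀ s, M s = Q s * Real.exp (A s) := fun s => by rw [hMt, hQs, hAs]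
  have hAd : ∀ s ∈ Icc 0 t, HasDerivWithinAt A (G s) (Icc 0 t) s := by
    intro s hs; rw [hA]; exact hprim hGc' s hs
  have hQd : ∀ s ∈ Icc 0 t, HasDerivWithinAt Q (R s) (Icc 0 t) s := by
    intro s hs; rw [hQ]; exact (hprim hRc' s hs).const_add _
  have hA0 : ∀ s ∈ Icc 0 t, 0 ≤ A s := by
    intro s hs
    rw [hAs]
    exact intervalIntegral.integral_nonneg hs.1 fun σ hσ => hG0 σ (hsub ⟨hσ.1, hσ.2.trans hs.2⟩)
  have hQ0 : ∀ s ∈ Icc 0 t, 0 ≤ Q s := by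
    intro s hs
    rw [hQs]
    exact add_nonneg (Real.sqrt_nonneg _)
      (intervalIntegral.integral_nonneg hs.1 fun σ hσ => hR0 σ (hsub ⟨hσ.1, hσ.2.trans hs.2⟩))
  -- derivative of `M²`
  obtain ⟨D, hD⟩ : ∃ D : ℝ → ℝ,
      D = fun s => 2 * M s * (R s * Real.exp (A s) + Q s * (Real.exp (A s) * G s)) := ⟨_, rfl⟩
  have hDs : ∀ s, D s = 2 * M s * (R s * Real.exp (A s) + Q s * (Real.exp (A s) * G s)) :=
    fun s => by rw [hD]
  have hMd : ∀ s ∈ Icc 0 t,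
      HasDerivWithinAt M (R s * Real.exp (A s) + Q s * (Real.exp (A s) * G s)) (Icc 0 t) s := by
    intro s hs
    have h := (hQd s hs).mul (hAd s hs).exp
    have hM' : M = fun s => Q s * Real.exp (A s) := funext hMQA
    rw [hM']
    exact h
  have hM2d : ∀ s ∈ Icc 0 t, HasDerivWithinAt (fun s => M s ^ 2) (D s) (Icc 0 t) s := by
    intro s hs
    have h := (hMd s hs).pow 2
    refine h.congr_deriv ?_
    rw [hDs]
    norm_num
  have hAc : ContinuousOn A (Icc 0 t) := fun s hs => (hAd s hs).continuousWithinAt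
  have hQc : ContinuousOn Q (Icc 0 t) := fun s hs => (hQd s hs).continuousWithinAt
  have hMc : ContinuousOn M (Icc 0 t) := fun s hs => (hMd s hs).continuousWithinAt
  have hexpc : ContinuousOn (fun s => Real.exp (A s)) (Icc 0 t) := hAc.rexp
  have hDc : ContinuousOn D (Icc 0 t) := by
    rw [hD]
    exact (continuousOn_const.mul hMc).mul ((hRc'.mul hexpc).add (hQc.mul (hexpc.mul hGc')))
  -- `2 G M² + 2 R M ≤ D` on `[0, t]`
  have hkD : ∀ s ∈ Icc 0 t, 2 * G s * M s ^ 2 + 2 * R s * M s ≤ D s := by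
    intro s hs
    have hG := hG0 s (hsub hs)
    have hR := hR0 s (hsub hs)
    have hM := hM0 s (hsub hs)
    have hexp1 : 1 ≤ Real.exp (A s) := Real.one_le_exp (hA0 s hs)
    rw [hDs]
    have hQA : Q s * (Real.exp (A s) * G s) = M s * G s := by rw [hMQA]; ring
    rw [hQA]
    have h1 : R s ≤ R s * Real.exp (A s) := by nlinarith
    nlinarith
  -- FTC for `M²` on `[0, t]`
  have hFTC : ∫ s in (0 : ℝ)..t, D s = M t ^ 2 - M 0 ^ 2 :=
    intervalIntegral.integral_eq_sub_of_hasDerivAt_of_le h0.le (hMc.pow 2)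
      (fun s hs => (hM2d s (Ioo_subset_Icc_self hs)).hasDerivAt (Icc_mem_nhds hs.1 hs.2))
      (hDc.intervalIntegrable_of_Icc h0.le)
  have hM0sq : M 0 ^ 2 = E 0 := by
    rw [hMt, intervalIntegral.integral_same, intervalIntegral.integral_same, add_zero, Real.exp_zero,
      mul_one, Real.sq_sqrt (hE0 0)]
  -- integrate the balance with the dissipation kept
  have hΦii : IntervalIntegrable Φ volume 0 t :=
    (intervalIntegrable_iff_integrableOn_Ioo_of_le h0.le).2 (hΦi.mono_set (Ioo_subset_Ioo le_rfl ht.2))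
  have hDFii : IntervalIntegrable (fun s => 2 * ν * DF s) volume 0 t :=
    (continuousOn_const.mul hDFc').intervalIntegrable_of_Icc h0.le
  have hkc : ContinuousOn (fun s => 2 * G s * M s ^ 2 + 2 * R s * M s) (Icc 0 t) :=
    ((continuousOn_const.mul hGc').mul (hMc.pow 2)).add ((continuousOn_const.mul hRc').mul hMc)
  have hmono1 : ∫ s in (0 : ℝ)..t, (Φ s + 2 * ν * DF s) ≤
      ∫ s in (0 : ℝ)..t, (2 * G s * M s ^ 2 + 2 * R s * M s) :=
    intervalIntegral.integral_mono_on h0.le (hΦii.add hDFii) (hkc.intervalIntegrable_of_Icc h0.le)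
      fun s hs => hslab s (hsub hs)
  have hmono2 : ∫ s in (0 : ℝ)..t, (2 * G s * M s ^ 2 + 2 * R s * M s) ≤ ∫ s in (0 : ℝ)..t, D s :=
    intervalIntegral.integral_mono_on h0.le (hkc.intervalIntegrable_of_Icc h0.le)
      (hDc.intervalIntegrable_of_Icc h0.le) hkD
  have hsplit : ∫ s in (0 : ℝ)..t, (Φ s + 2 * ν * DF s) =
      (∫ s in (0 : ℝ)..t, Φ s) + 2 * ν * ∫ s in (0 : ℝ)..t, DF s := by
    rw [intervalIntegral.integral_add hΦii hDFii, intervalIntegral.integral_const_mul]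
  have hb := hEb t ⟨h0, ht.2⟩
  rw [← hEt, ← hEt] at hb
  have hb' : E t = E 0 + ∫ s in (0 : ℝ)..t, Φ s := by
    rw [hb]; congr 1
    exact intervalIntegral.integral_congr fun s _ => (hΦt s).symm
  -- assemble
  have hgoal : E t + 2 * ν * ∫ s in (0 : ℝ)..t, DF s ≤ M t ^ 2 := by
    have := hmono1.trans hmono2
    rw [hsplit, hFTC, hM0sq] at this
    linarith
  have e1 : ∫ s in (0 : ℝ)..t, DF s =
      ∫ s in (0 : ℝ)..t, ∫ x, FluidPDE.frobeniusNormSq (fderiv ℝ (fun y => u s y - u' s y) x) := by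
    refine intervalIntegral.integral_congr fun s _ => ?_
    rw [hDFt]
  rw [← hEt, ← e1, ← hEt, ← hMt]
  exact hgoal

end Slab

end Literature.Analysis.FluidPDE

end
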